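/-
Copyright: publication-cell `pub-balaban` (b2b), seat b2b-balaban-b10 gens 17–18 (v1.1).  Literature leaf — one-variable
complex analysis (Schwarz–Cauchy estimates on discs and strips), finite bookkeeping and normed-ring algebra only; every theorem is kernel-proved
and tagged [folklore] or [cite: …] (a LOCATED printed shape); the `def … : Prop` leaves are HYPOTHESIS SHAPES, consumed
as hypotheses and never asserted; NO new cited facts, NO summit vocabulary.
-/
import Mathlib
import Literature.Analysis.Complex.CauchyTaylorBall
import Literature.MathematicalPhysics.QuantumFieldTheory.Balaban1983to89.B10LogDet63
import Literature.MathematicalPhysics.QuantumFieldTheory.Balaban1983to89.B10Eq63Rep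

/-!
# `Balaban1983to89.B10Eq61PerSite` — [Balaban1985UV3] (61) and p. 272: the `U_{k+1} = 1` subtraction and the
# SMALLNESS of what survives it, kernel-derived from analyticity along the complex line `ζ ↦ exp iζη𝓗(B)`
# (the mechanism (29)–(30), (32) of the paper) — the per-site / per-cube smallness `θ` that
# `B10LogDet63.logHalfBound_perSite` and `B13.bound118_of_logHalfBound_literal` take as a bare input

T. Bałaban, *Ultraviolet stability of three-dimensional lattice pure gauge field theories*, Commun. Math. Phys. **102**,
255–275 (1985) [Balaban1985UV3] (cell paper B10; PDF `paper:balaban1985-cmp102-uv-stability-3d`, journal page = PDF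
page + 254; renders `1985-cmp102-uv-stability-3d-p009/p010/p017/p018-x2.png` of pp. 263, 264, 271, 272 READ AS IMAGES
for this module).  Consumer for d = 4: T. Bałaban, *Renormalization group approach to lattice gauge field theories.
II*, Commun. Math. Phys. **116**, 1–22 (1988) [Balaban1988RG2Cluster], p. 21 (render `1988-cmp116-rg-II-cluster-p021-
x2.png` READ AS IMAGE).  Siblings (imported, not modified): `…B10LogDet63` ((61)–(63) at operator level, the walk-term
bookkeeping `logHalfBound_of_walks` / `logHalfBound_perSite` / `logHalfBound_integral63`), `…B10Eq63Rep` (the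
representation leaf `G3Rep`); the tree's `Literature.Analysis.Complex.CauchyTaylorBall` (Taylor remainders from a sup
bound on a ball).

WHY THIS MODULE (cell GAPS G-adv5-5 REPAIR, G-B13-12a, G-B10-06; the b10 lineage's own open edge).  The d = 4 consumer
says (p. 21): the localized pieces of `log Z^{(k)}(U_{k+1}) − log Z^{(k)}(1)` satisfy (I.1.18) *"with an absolute
constant instead of E₀"*.  The cell's referee (G-adv5-5) observed that for X = one LM-cube the pieces are sums over
(LM)⁴ sites, so an X-independent ABSOLUTE constant needs a PER-SITE SMALLNESS of the U-dependent DIFFERENCE — a lemma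
written nowhere in the series; `B13` Part G typed the two readings ((a) `B = A·θ·(LM)⁴`, θ a per-site smallness,
absolute after the printed restriction R21; (b) `B = A·(LM)⁴`) and `B10LogDet63.logHalfBound_perSite` made the
dichotomy structural — both with `θ` a BARE INPUT.  This module derives `θ` from the mechanism the paper itself names
for the subtraction: p. 272 *"gathering together the first terms in the expansions (30) we obtain the expansion of (63)
for the external field U_{k+1} = 1. This is cancelled by the second term in (61)"* — i.e. every localized term is
expanded, as in (29)–(30), along `U = exp i𝓗(B)` around `𝓗 = 0`, and its ZEROTH-ORDER term (the value at `U = 1`) is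
removed by (61).  What survives is `f(1) − f(0)` for `f(ζ) :=` (the term at the configuration `exp iζη𝓗(B)`), a
function holomorphic in `ζ` (p. 263: *"The third property is the analyticity with respect to U₁"*) and bounded by the
UNDIFFERENCED bound on the disc `|ζ| < ρ` on which the complexified configuration stays in the analyticity domain;
the Schwarz–Cauchy estimate then gives `|f(1) − f(0)| ≤ (2/ρ)·sup|f|`.  Hence `θ = 2/ρ`, where `ρ` = (radius of the
background-field analyticity domain of the (63)-terms) / (size of the actual deviation `η𝓗(B)`, cf. (28)).  With the
first-order term also absent ((32): *"(δ/δ𝓗(b) 𝒫′₁)(g₀, X, 1) = 0"*, semi-simplicity) the factor is `8/ρ²` (`ρ ≥ 4`),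
and the order-N remainder of (30) carries `2(2/ρ)^N`.

CITATION HEADER (lean-in-tree rule).  WHAT IS REPRODUCED, verbatim from the renders, in §0 below: p. 263 (the three
properties; the gauge `exp i𝓗(B)`; (28); (29); the sentence before (30)), p. 264 ((32) and the sentence after it),
p. 271 (the expansion recipe for `𝒫′_{k+1}`; (61); *"expand the term (61) analogously to (60)"*), p. 272 (the two
sentences on the cancellation), and [Balaban1988RG2Cluster] p. 21 (the "absolute constant" sentence); v1.1 adds
[Balaban1985BackgroundPropagators] (3.35), (3.37) p. 396 and (3.69) p. 404, [Balaban1987RG1] (1.11)–(1.13) p. 262, and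
[Balaban1988RG2Cluster] p. 15 (the analyticity spaces of the covariances; the meaning of its `O(α₀ + α₁)`).

WHAT IS KERNEL-CERTIFIED (theorems of one-variable complex analysis, finite/countable bookkeeping and normed-ring
algebra — no object of the papers is constructed):
* §1 [folklore] — `norm_sub_apply_zero_le` / `norm_sub_le_two_div`: `f` holomorphic on the disc `|ζ| < ρ` with
  `‖f‖ ≤ K` there ⇒ `‖f z − f 0‖ ≤ (2K/ρ)|z|` (Schwarz lemma, `Complex.dist_le_div_mul_dist_of_mapsTo_ball`), so
  `‖f 1 − f 0‖ ≤ (2/ρ)K` for `ρ > 1`; `norm_sub_taylor_le_of_four_le`: the order-N remainder at `ζ = 1` is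
  `≤ 2K(2/ρ)^N` for `ρ ≥ 4` (the tree's `CauchyTaylorBall`); `norm_sub_le_of_deriv_zero`: `f′(0) = 0` ⇒
  `‖f 1 − f 0‖ ≤ (8/ρ²)K`.
* §2 — THE LEAF, typed over the vocabulary of `B13`/`B10LogDet63` (domains `D : LocDomainSys`, spaces `sp X ⊆ Φ`,
  families `E X φ`): a complex LINE `line : Φ → ℂ → Φ` through each configuration (`line φ 1 = φ`, `line φ 0` = the same
  configuration with `U_{k+1}` replaced by `1`; for the print `line φ ζ = exp iζη𝓗(B)`); (L1) `LineInDomain sp' sp line ρ`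
  — from the (smaller, real) spaces `sp'` the line stays inside the analyticity spaces `sp` for `|ζ| < ρ`; (L2)
  `AnalyticAlong sp' E line ρ` — each localized term is holomorphic along it; (L3) `DerivZeroAlong` — the (32)-shape.
  PROVED: `logHalfBound_diffAlong` — (L1)+(L2)+`B13.LogHalfBound D sp E nX B r` ⇒ the DIFFERENCED family
  `diffAlong E line X φ = E X (line φ 1) − E X (line φ 0)` obeys `B13.LogHalfBound D sp' … nX ((2/ρ)·B) r` (same rate,
  per-cube constant multiplied by `θ = 2/ρ`; any `θ ≥ 2/ρ` may be booked, `logHalfBound_diffAlong_of_le`); with (L3) and `ρ ≥ 4` the constant is `(8/ρ²)·B`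
  (`logHalfBound_diffAlong_of_derivZero`); the order-N remainder family obeys `2(2/ρ)^N·B` (`logHalfBound_taylorRemAlong`,
  the (30)/(60) shape *"+ O(g₀⁷)e^{−κℒ(X)}"*); x-dependent families integrated over `[0, a]` ((61) = the x-integral of
  (63)): constant `a·(2/ρ)·B` (`logHalfBound_integral_diffAlong`).  §2b, TERM LEVEL (the literal per-SITE smallness):
  the differenced walk terms `diffTerm term line` obey the (23)-type bound with `K ↦ K·(2/ρ)` (`walkBound_diffTerm`),
  whence `B10LogDet63.logHalfBound_perSite` applies with `θ = 2/ρ` (`logHalfBound_diffTerm`), the x-uniform leaf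
  transfers (`g3WalkBound_diffTerm`, `logHalfBound_integral61`), the two entry points agree (`Elog_diffTerm_eq`:
  localizing the differenced terms = differencing the localized family), and the representation leaf of `B10Eq63Rep`
  passes to differences (`g3Rep_diffTerm`: `R(U) − R(1) = Σ_ω (term_ω(U) − term_ω(1))`).
* §3 — READING (a) OF "ABSOLUTE", DERIVED MODULO THE LEAF (`bound118_literal_of_analyticRadius`): if the undifferenced
  pieces obey the per-cube shape with `B = A·(LM)⁴` (O(1) per site — all that (44)–(46) of the paper assert) on spaces
  `sp` which contain the complex lines of radius `ε/α₀` issued from the evaluation spaces `sp'` (ε = the radius of the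
  background-field analyticity domain of the (63)-terms in the units in which `sp'` = Uᶜ_{k+1}(X, α₀, α₁) has radius
  α₀), then the differenced pieces obey (I.1.18) on `sp'` with the constant `2·(2A/ε)·c₁` and rate `r − 1` — by
  `B13.bound118_of_logHalfBound_literal` with `θ := α₀` and the printed R21 `(LM)⁴α₀ ≤ 1` — ABSOLUTE iff the leaf (L1)
  holds at radius `ε/α₀` with `ε` L, M-independent, which, the gauge-fixed BOND deviation of a configuration of
  Uᶜ_{k+1}(X, α₀, α₁) being `O(1)LMBα₀` by [Balaban1987RG1] (1.12) p. 262 (α₀ bounds PLAQUETTES, (1.11)) — times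
  `(1 + d_{k+1}(X))` for ONE gauge on the whole dependence set — requires the
  (63)-terms' analyticity domain to be plaquette-stated and the line to stay in it beyond the linear regime; a
  bond-stated domain gives `ρ ≤ ε/(O(1)LMBα₀ + α₁)` and a surviving factor `O(1)B·LM` after R21 (DOCFIX v1.1, cell GAPS
  C-adv2-63 O1; the first-order mechanism of this § is therefore NOT the route to an absolute constant — §3b is).  The
  v1 question "is ε independent of L, M" thus has TWO data (ε and the variables it is stated in; the ratio
  bond-deviation/α₀ = O(1)LMB of (1.12)); the printed domains are POTENTIAL-stated ([5] (3.35)/(3.37), [I] (1.12)/(1.13),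
  §0 v1.1) and the located answer is in §§2c–3b.
* §4 [folklore] — the OPERATOR-LEVEL form of the same smallness, recorded for the walk terms themselves (not used by
  §§2–3): the second resolvent identity with the `x·1` shift, `(x·1 + T₁)⁻¹ − (x·1 + T₀)⁻¹ = (x·1 + T₁)⁻¹ (T₀ − T₁) (x·1 +
  T₀)⁻¹` — the middle factor is x-FREE, which is why a smallness of `T₀ − T₁ = C*(Δ_k(1) − Δ_k(U))C` is x-uniform
  (`resolvent_sub_resolvent`); and the telescoping bound for ordered products in a normed ring,
  `‖Π aᵢ − Π bᵢ‖ ≤ n·θ·Π cᵢ` when `‖aᵢ‖, ‖bᵢ‖ ≤ cᵢ`, `‖aᵢ − bᵢ‖ ≤ θcᵢ` (`norm_prod_sub_prod_le`) — the shape by which a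
  walk term (a product of `|ω| + O(1)` local factors, [5] (3.107)) inherits a per-step smallness with a factor linear in
  `|ω|`, summable against `q^{|ω|}`.
* §5 — non-vacuity: the leaves (L1)–(L2) and the undifferenced bound are jointly satisfiable by a NON-CONSTANT family
  (`example`s on the one-domain system `unitSys`), so `logHalfBound_diffAlong` is not an implication from `False`.

v1.1 (gen 18) — THE LOCATED HALF-WIDTH AND THE SECOND ORDER (cell GAPS C-adv2-63 O1/A1, G-B13-12a, G-adv5-5).  The
printed analyticity spaces are POTENTIAL-stated: [5] = [Balaban1985BackgroundPropagators] (3.35) *"|A| < O(1)Mα₀(L^jη)^{−1} … where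
O(1)M is a size of □"*, (3.37) *"|A′| < α₁(L^jη)^{−1}"*, (3.69) *"O(1)(Mα₀ + α₁)"*; [I] (1.12) *"|A|, |∇^ξA| < O(1)LMBα₀
on □"* (cubes of size O(1)LM, REAL part, gauge freedom), (1.13) *"|A′|, |∇^ξ_U A′| < α₁ on X"* (COMPLEX part, no LM, no
gauge freedom); and [Balaban1988RG2Cluster] p. 15 places the covariance-type objects on the BIG space: *"The quadratic
forms and covariances in H(Z) are analytic functions on the space of configurations (𝐔, 𝐉) satisfying the conditions
I.(i)–(iii) on the domain Z, with constants α′₀, α′₁ much bigger than α₀, α₁"*.  Along the whole-configuration line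
`ζ ↦ exp iζη𝓗` the imaginary direction turns the REAL gauge-fixed potential — of size `O(1)·B·LM·α₀·(1 + d_{k+1}(X))`
over the localization domain — into a COMPLEX part, which the big space bounds by `α′₁` with NO factor LM: the region of
analyticity around the real segment `[0, 1]` is a STRIP of X-DEPENDENT half-width `h_X ≈ α′₁/(α₁ + c₀·LM·α₀·(1 + d(X)))`,
not a disc of L, M-independent radius (and `h_X < 1` for large X, where §1's disc lemmas do not apply).
* §1b [folklore] — STRIP Cauchy estimates valid for EVERY `h > 0`: on the rectangle `Rect h` of half-width `h` around
  `[0, 1]`, `‖f‖ ≤ K` ⇒ `‖f′‖ ≤ K/r` at sup-distance `≥ r` from the boundary (`norm_deriv_le_of_rect`,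
  `Complex.norm_deriv_le_of_forall_mem_sphere_norm_le`), `‖f 1 − f 0‖ ≤ (2/h)K` (`norm_sub_le_two_div_of_rect`, mean
  value inequality on the segment) and, when `f′(0) = 0`, `‖f 1 − f 0‖ ≤ (8/h²)K` (`norm_sub_le_of_rect_derivZero`).
* §2c — the leaves on strips with X-dependent lines and half-widths: (L1′) `LineInStrip sp' sp line h`, (L2′)
  `AnalyticOnStrip`, (L3′) `DerivZeroAlongV` (the (32)-shape — PRINTED for `𝒫′₁`, `𝒫′_{k+1}` (pp. 264, 271); for the
  (61)-pieces p. 271 says only *"analyzed in the same way as the perturbative expressions"*: a LEAF, cell GAPS C-adv2-63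
  R1); `diffAlongV`.  PROVED: with `1/h X ≤ θ₀(1 + d(X))` the differenced family obeys the per-cube shape with constant
  `2θ₀·B`, rate `r − 1` (`logHalfBound_diffAlongV`), and with (L3′) constant `8θ₀²·B`, rate `r − 2`
  (`logHalfBound_diffAlongV_of_derivZero`; x-integrated: `logHalfBound_integral_diffAlongV_of_derivZero`); the printed
  half-width shape `h = a/(p + q(1 + d))` satisfies the hypothesis with `θ₀ = (p + q)/a` (`inv_halfWidth_le`); and TWO
  REGIMES (`logHalfBound_diffAlongV_twoRegime`): the line and (L1′)–(L3′) only on the domains with `d(X) ≤ d₀`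
  (spaces `below d₀ sp'`), the endpoints in the domain everywhere (L0′ `EndpointsIn`) and the crude bound `2B` on the
  large domains ⇒ constant `8θ₀²B + 2B·e^{−2d₀}`, rate `r − 2` (cf. p. 263: the expansion (29)–(30) is performed for X
  *"contained in a cube □ of the size RM₁"*, the gauge living on `□₁` of size 3RM₁; paying the larger domains by the
  decay factor is this module's bookkeeping, cell DIVERGENCE D-b10.22).
* §3b — THE POINT, in the letters of [Balaban1988RG2Cluster] (`θ₀ = (α₁ + c₀·LM·α₀)/a`, `a` = α′₁, undifferenced
  per-LM-cube constant `A(LM)⁴`, printed R21): FIRST ORDER gives the per-cube constant `2A(1 + c₀·LM)/a` — one power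
  of `LM` SHORT of absolute (`firstOrder_of_R21`, `logHalfBound_firstOrder_of_R21`; = C-adv2-63 O1(i), typed); SECOND
  ORDER gives `16A(1 + c₀²)/a²` — INDEPENDENT of L, M, because `(LM)⁴(LM·α₀)² = ((LM)⁴α₀)²(LM)⁻² ≤ 1` and
  `(LM)⁴α₁² ≤ 1` are within R21 (`secondOrder_of_R21`, `logHalfBound_secondOrder_of_R21`), whence (I.1.18) for the
  differenced pieces with the L, M-independent constant `(16A(1 + c₀²)/a²)·c₁` and rate `r − 3`
  (`bound118_secondOrder_of_R21`); two regimes with `(LM)⁴e^{−2d₀} ≤ 1` (e.g. `d₀ = 2 log(LM)`, a choice of this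
  module): constant `16A(1 + c₀²)/a² + 2A` (`logHalfBound_secondOrder_twoRegime_of_R21`).  READING (a) — p. 21 *"with an absolute constant instead of E₀"* — is thus REACHED
  by the paper's own mechanism (32) (*"there are no relevant variables in the effective action"*) under the PRINTED
  restriction R21 alone, modulo the leaves (L1′)–(L3′), the undifferenced bound and the located half-width shape, at
  the price of three units of the decay rate `r = δ₀M` (immaterial next to the printed *"δ₀M ≥ κ"*, p. 21).  In neither
  printed domain does the FIRST-order factor `θ(LM)⁴` become O(1) under R21 (C-adv2-63 A1) — the second order is what
  R21 pays for.  Nothing printed is asserted; all inputs are hypotheses.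
* §5b — non-vacuity of the strip leaves incl. (L3′): the family `φ²` along `ζ ↦ ζφ` (non-constant, `f′(0) = 0`
  non-trivially) satisfies (L1′)–(L3′) and the undifferenced bound, and `logHalfBound_diffAlongV_of_derivZero` applies.

HONEST SCOPE.  (i) Nothing of the series is asserted: (L1)–(L3) and the undifferenced `LogHalfBound` are hypotheses;
the module proves what they imply.  (ii) Which RADII print supplies is NOT decided (see §3): for the REAL small fields of
[Balaban1985UV3] the deviation is (28) *"|B(c)| < 4L²|c₋ − y|g₀p(g₀) < 8L²3R₁M₁r(g₀)g₀p(g₀)"* — small, and growing with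
the size `3RM₁` of the gauge-fixing cube — against an analyticity radius fixed by the previous papers, so `θ = 2/ρ` is
`O(L²RM₁r(g₀)g₀p(g₀))`-small there; for the COMPLEX domain Uᶜ_{k+1}(X, α₀, α₁) of [Balaban1988RG2Cluster] the ratio is
`ε/α₀` with `ε` as in §3 — v1.1: the printed domains being potential-stated, the relevant datum is the X-dependent
half-width `h_X` of §§2c–3b, not a radius.  (iii) GAUGE: the smallness is that of `𝓗(B)` in the special gauge of p. 263 (*"there exists
a gauge transformation in a neighbourhood of □₁ … such that the gauge transformed U₁ is represented as exp i𝓗(B)"*),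
transported to the terms by their gauge invariance (26)/(29); the line `ζ ↦ exp iζη𝓗(B)` is a datum of the leaf, not
constructed.  (iv) The module is NOT a proof of (24), of (I.1.18), of Theorem 2 or of any estimate of the series, and
NOT summit progress; it is the kernel form of one sentence of p. 272 plus the Schwarz lemma (v1.1: plus the Cauchy
estimate on strips and the R21 arithmetic at second order).  (v) v1.1 does NOT decide that the (61)-pieces satisfy
(L3′) (printed for 𝒫′ only, R1), nor the values of `a = α′₁`, `c₀ = O(1)·B`, `A` (absolute in print: [I] (1.12) *"with a
sufficiently large constant B (it will be determined later)"*, p. 15 *"much bigger than α₀, α₁"*; not re-audited), nor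
the semi-simplicity caveat of (32) (U(1) excluded by the paper).

## §0. The printed sentences (verbatim, read off the renders for this module)

[Balaban1985UV3] p. 263: *"for all gauge transformations 𝓊. The second is a localization property with respect to U₁.
The expression 𝒫′₁(g₀, X, U₁) depends on U₁ restricted to the set X̃⁵ … The third property is the analyticity with
respect to U₁. These properties follow from the results of previous papers"*; *"According to these there exists a gauge
transformation in a neighbourhood of □₁, where □₁ is a cube of the size 3RM₁ and with the same center as □, such that
the gauge transformed U₁ is represented as exp i𝓗(B) in the neighbourhood of □₁. The function 𝓗(B) is represented as
𝓗(B) = HB + A₁"*; *"The characteristic functions χ₁ defined in (13) give the restrictions |V(∂p′) − 1| < 2L²g₀p(g₀),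
hence |B(c)| < 4L²|c₋ − y|g₀p(g₀) < 8L²3R₁M₁r(g₀)g₀p(g₀), (28) and for g₀ sufficiently small the number on the
right-hand side above is small."*; *"By the gauge invariance (26), we have 𝒫′₁(g₀, X, U₁) = 𝒫′₁(g₀, X, exp i𝓗(B)), (29)
and we expand the function with respect to 𝓗(B). Because of the bound (28) it is enough to expand up to the sixth
order, hence"* [(30): the Taylor expansion of `𝒫′₁(g₀, X, exp i𝓗(B))` around `𝓗 = 0` to order six, remainder
`O(g₀⁷)e^{−κℒ(X)}`].
p. 264: *"(δ/δ𝓗(b) 𝒫′₁)(g₀, X, 1) = 0. (32) It is the only place we use the semi-simplicity, but the above conclusion is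
a fundamental point in our method. In the renormalization group language it is the statement that there are no relevant
variables in the effective action."*
p. 271: *"representation U_{k+1} = exp iη𝓗(B) (modulo a gauge transformation) in a neighbourhood of □₁. … We expand
the function 𝒫′_{k+1}(g_k, X, exp iη𝓗(B)) with respect to 𝓗(B) at first, up to the sixth order, so we have the formula
(30) (for η-scale). The same conclusion (32) holds for the first order functional derivative of 𝒫′_{k+1}(g_k, X, exp iη𝓗)
at 𝓗 = 0."*; *"we obtain the inductive inequality (41) for k replaced by k + 1, but with the additional term
log Z^{(k)}(B(Λ_{k+1}), U_{k+1}) − log Z^{(k)}(B(Λ_{k+1}), 1). (61)"*; *"To complete the proof of the inductive assumption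
(41) we have to expand the term (61) analogously to (60)."*
p. 272: *"By the above formula this gives an expansion of the last integral in (63) into a sum of gauge invariant,
localized terms. They are again analyzed in the way described before. Now let us notice that gathering together the
first terms in the expansions (30) we obtain the expansion of (63) for the external field U_{k+1} = 1. This is cancelled
by the second term in (61), and we obtain the desired expansion."*
[Balaban1988RG2Cluster] p. 21: *"We gather all terms in the expansions, localized in X, and we extend them to analytic
functions of 𝐔, 𝐉. The expression localized in X satisfies the bound (I.1.18) with κ replaced by δ₀M, and with an
absolute constant instead of E₀."*

v1.1 additions (renders `1985-cmp99-background-propagators-p008/p016-x2.png` = [Balaban1985BackgroundPropagators] pp. 396, 404;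
`1987-cmp109-rg-I-small-field-p014-x2.png` = [Balaban1987RG1] p. 262; `1988-cmp116-rg-II-cluster-p015-x2.png` =
[Balaban1988RG2Cluster] p. 15 — READ AS IMAGES):
[Balaban1985BackgroundPropagators] p. 396 (the regularity conditions of the background-field propagator paper [5]/[13]): *"for a
configuration U there exists a gauge transformation u on □ such that Uᵘ = e^{iηA}, and if the index of □ is j, then
|A| < O(1)Mα₀(L^jη)^{−1}, |∇^ηA| < O(1)Mα₀(L^jη)^{−2} on □, where O(1)M is a size of □ in T_{L^{−j}}; (3.35)"*; *"The
number α₀ characterizes this class of configurations. We will need α₀ so small that O(1)Mα₀ is still a sufficiently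
small number."*; *"We assume that they have the form U′U, where U has values in G and U′ = e^{iηA′}, A′ ∈ gᶜ. For a
given pair of positive numbers α₀, α₁ we consider the class of these configurations satisfying: U satisfies the
condition (3.35), and |A′| < α₁(L^jη)^{−1}, |∇^η_U A′| < α₁(L^jη)^{−2} on Ω_j, j = 0, …, k; (3.37)"*.
p. 404: *"|(Δ′(U′U)A′)(b)| ≤ O(1)(Mα₀ + α₁)(L^jη)^{−2}|A′|, b ∈ Ω_j (3.69)"*; *"This bound follows from the estimates
|Re(U′U)(∂p) − 1|, |Im(U′U)(∂p)| ≤ O(1)(Mα₀ + α₁)ξ², ξ = L^{−j}. … the estimates follow directly from the assumptions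
(3.35), (3.37)."*
[Balaban1987RG1] p. 262: *"The space Uᶜ_j(X, α₀, α₁, γ₀) is a union of orbits [(𝐔, 𝐉)] determined by configurations
𝐔, 𝐉 satisfying the four conditions written below. (i) 𝐔 = U′U, U has values in the group G, |∂U − 1| < α₀ξ² on X,
(1.11) for each cube □ ⊂ X of a size O(1)LM there exists a G-valued gauge transformation u defined on □ and such, that
Uᵘ = exp iξA, |A|, |∇^ξA| < O(1)LMBα₀ on □, (1.12) with a sufficiently large constant B (it will be determined
later). (ii) U′ = exp iξA′, A′ has values in the algebra gᶜ, |A′|, |∇^ξ_U A′| < α₁ on X. (1.13)"*; *"The first three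
conditions (i)–(iii) in the above definition are rather simple and natural, the conditions of this form appeared many
times in the previous papers, e.g. see (3.35)–(3.38) [13]."*
[Balaban1988RG2Cluster] p. 15: *"The potentials are also analytic functions on the subspace Uᶜ_{k+1}(X, α₀, α₁). The
quadratic forms and covariances in H(Z) are analytic functions on the space of configurations (𝐔, 𝐉) satisfying the
conditions I.(i)–(iii) on the domain Z, with constants α′₀, α′₁ much bigger than α₀, α₁, therefore we can restrict
them, as analytic functions, to the above subspace."*; *"We use the fact that, by the definition of the space, the
configuration 𝐔 can be written as 𝐔 = U′U, U′ = exp iL⁻¹ηA′, and A′, 𝐉 have values in gᶜ, but they are small. More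
precisely we have |A″|, |∇_U^{L⁻¹η}A′| < α₁, |𝐉| < α₀."*; *"In the expression on the right-hand side we replace the
operators by the corresponding operators with σ(Z) = 0, 𝐔 = U, 𝐉 = 0, and we estimate the error."* (so the
`O(α₀ + α₁)` of (2.16)–(2.17) there is the removal of U′ and 𝐉 at FIXED real U — not a U-versus-1 bound).
-/

noncomputable section

open Metric Set Filter Finset
open scoped Topology

namespace Literature.MathematicalPhysics.QuantumFieldTheory.Balaban1983to89.B10Eq61PerSite

/-! ## §1. The one-variable core: a function holomorphic and bounded on the disc `|ζ| < ρ` moves little between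
`ζ = 0` and `ζ = 1` when `ρ` is large [folklore] -/

section core

variable {F : Type*} [NormedAddCommGroup F] [NormedSpace ℂ F]

/-- **Schwarz–Cauchy estimate.**  `f` holomorphic on the disc `|ζ| < ρ` with `‖f‖ ≤ K` there ⇒
`‖f z − f 0‖ ≤ (2K/ρ)·|z|` on the disc (the Schwarz lemma for `f − f 0`, which maps the disc into the closed ball of
radius `2K`; `Complex.dist_le_div_mul_dist_of_mapsTo_ball`). [folklore] -/
theorem norm_sub_apply_zero_le {f : ℂ → F} {ρ K : ℝ} (hρ : 0 < ρ) (hf : DifferentiableOn ℂ f (ball 0 ρ))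
    (hK : ∀ ζ ∈ ball (0 : ℂ) ρ, ‖f ζ‖ ≤ K) {z : ℂ} (hz : z ∈ ball (0 : ℂ) ρ) :
    ‖f z - f 0‖ ≤ 2 * K / ρ * ‖z‖ := by
  have hmaps : MapsTo f (ball (0 : ℂ) ρ) (closedBall (f 0) (2 * K)) := by
    intro w hw
    rw [mem_closedBall, dist_eq_norm]
    calc ‖f w - f 0‖ ≤ ‖f w‖ + ‖f 0‖ := norm_sub_le _ _
      _ ≤ K + K := add_le_add (hK w hw) (hK 0 (mem_ball_self hρ))
      _ = 2 * K := by ring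
  have h := Complex.dist_le_div_mul_dist_of_mapsTo_ball hf hmaps hz
  rwa [dist_eq_norm, dist_eq_norm, sub_zero] at h

/-- At `ζ = 1`, `ρ > 1`: `‖f 1 − f 0‖ ≤ (2/ρ)·K` — the value at the actual configuration minus the value at `U = 1` is
the undifferenced bound times `θ = 2/ρ`.  For `ρ → 1⁺` this is the crude bound `2K` of `B10LogDet63.logHalfBound_sub`;
the smallness is the excess of the analyticity radius over the deviation. [folklore] -/
theorem norm_sub_le_two_div {f : ℂ → F} {ρ K : ℝ} (hρ : 1 < ρ) (hf : DifferentiableOn ℂ f (ball 0 ρ))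
    (hK : ∀ ζ ∈ ball (0 : ℂ) ρ, ‖f ζ‖ ≤ K) : ‖f 1 - f 0‖ ≤ 2 / ρ * K := by
  have h1 : (1 : ℂ) ∈ ball (0 : ℂ) ρ := by rw [mem_ball_zero_iff, norm_one]; exact hρ
  calc ‖f 1 - f 0‖ ≤ 2 * K / ρ * ‖(1 : ℂ)‖ := norm_sub_apply_zero_le (lt_trans zero_lt_one hρ) hf hK h1
    _ = 2 / ρ * K := by rw [norm_one]; ring

variable [CompleteSpace F]

/-- **Order `N`** (the mechanism of (30): *"it is enough to expand up to the sixth order"*): for `ρ ≥ 4` the Taylor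
remainder of order `N` at `ζ = 1` is at most `2K·(2/ρ)^N` (the tree's
`Literature.Analysis.Complex.norm_sub_taylor_le_of_forall_mem_ball` at `c = 0`, `z = 1`). [folklore] -/
theorem norm_sub_taylor_le_of_four_le {f : ℂ → F} {ρ K : ℝ} (hρ : 4 ≤ ρ) (hf : DifferentiableOn ℂ f (ball 0 ρ))
    (hK : ∀ ζ ∈ ball (0 : ℂ) ρ, ‖f ζ‖ ≤ K) (N : ℕ) :
    ‖f 1 - ∑ n ∈ Finset.range N, (n.factorial : ℂ)⁻¹ • iteratedDeriv n f 0‖ ≤ 2 * K * (2 / ρ) ^ N := by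
  have hρ0 : 0 < ρ := by linarith
  have hz : ‖(1 : ℂ) - 0‖ ≤ ρ / 4 := by rw [sub_zero, norm_one]; linarith
  have h := Literature.Analysis.Complex.norm_sub_taylor_le_of_forall_mem_ball hρ0 hf hK hz N
  simpa only [sub_zero, one_pow, one_smul, norm_one, mul_one] using h

/-- **First-order term absent** (the shape of (32): the derivative at `𝓗 = 0` vanishes, *"there are no relevant
variables"*): `f′(0) = 0` ⇒ `‖f 1 − f 0‖ ≤ (8/ρ²)·K` for `ρ ≥ 4` — second-order smallness. [folklore] -/
theorem norm_sub_le_of_deriv_zero {f : ℂ → F} {ρ K : ℝ} (hρ : 4 ≤ ρ) (hf : DifferentiableOn ℂ f (ball 0 ρ))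
    (hK : ∀ ζ ∈ ball (0 : ℂ) ρ, ‖f ζ‖ ≤ K) (h0 : deriv f 0 = 0) : ‖f 1 - f 0‖ ≤ 8 / ρ ^ 2 * K := by
  have h := norm_sub_taylor_le_of_four_le hρ hf hK 2
  simp only [Finset.sum_range_succ, Finset.range_one, Finset.sum_singleton, Nat.factorial_zero, Nat.cast_one,
    inv_one, one_smul, iteratedDeriv_zero, iteratedDeriv_one, h0, smul_zero, add_zero, Nat.factorial_one] at h
  calc ‖f 1 - f 0‖ ≤ 2 * K * (2 / ρ) ^ 2 := h
    _ = 8 / ρ ^ 2 * K := by ring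

end core

/-! ## §1b. The strip form of the core [folklore]: a function holomorphic and bounded on the RECTANGLE of half-width
`h` around the real segment `[0, 1]` — valid for EVERY `h > 0` (the disc lemmas of §1 need `ρ > 1`, `ρ ≥ 4`) -/

section strip

variable {F : Type*} [NormedAddCommGroup F] [NormedSpace ℂ F]

/-- The open rectangle of half-width `h` around the real segment `[0, 1]` of the `ζ`-plane:
`−h < Im ζ < h`, `−h < Re ζ < 1 + h`. [folklore] -/
def Rect (h : ℝ) : Set ℂ := {ζ : ℂ | -h < ζ.im ∧ ζ.im < h ∧ -h < ζ.re ∧ ζ.re < 1 + h}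

/-- Membership in `Rect h`, unfolded. [folklore] -/
theorem mem_rect {h : ℝ} {ζ : ℂ} : ζ ∈ Rect h ↔ -h < ζ.im ∧ ζ.im < h ∧ -h < ζ.re ∧ ζ.re < 1 + h := Iff.rfl

/-- The rectangle is open. [folklore] -/
theorem isOpen_rect (h : ℝ) : IsOpen (Rect h) := by
  have e : Rect h = {ζ : ℂ | -h < ζ.im} ∩ {ζ : ℂ | ζ.im < h} ∩ {ζ : ℂ | -h < ζ.re} ∩ {ζ : ℂ | ζ.re < 1 + h} := by
    ext ζ; simp only [mem_rect, mem_inter_iff, mem_setOf_eq]; tauto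
  rw [e]
  exact (((isOpen_lt continuous_const Complex.continuous_im).inter
    (isOpen_lt Complex.continuous_im continuous_const)).inter
    (isOpen_lt continuous_const Complex.continuous_re)).inter (isOpen_lt Complex.continuous_re continuous_const)

/-- Rectangles are monotone in the half-width. [folklore] -/
theorem rect_mono {h h' : ℝ} (hle : h' ≤ h) : Rect h' ⊆ Rect h := by
  intro ζ hζ
  rw [mem_rect] at hζ ⊢
  obtain ⟨h1, h2, h3, h4⟩ := hζ
  exact ⟨by linarith, by linarith, by linarith, by linarith⟩

/-- `0 ∈ Rect h` for `h > 0`. [folklore] -/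
theorem zero_mem_rect {h : ℝ} (hh : 0 < h) : (0 : ℂ) ∈ Rect h := by
  rw [mem_rect, Complex.zero_im, Complex.zero_re]
  exact ⟨by linarith, hh, by linarith, by linarith⟩

/-- The real segment `[0, 1]` lies in every rectangle of positive half-width. [folklore] -/
theorem segment_subset_rect {h : ℝ} (hh : 0 < h) : segment ℝ (0 : ℂ) 1 ⊆ Rect h := by
  rw [segment_eq_image]
  rintro _ ⟨s, ⟨hs0, hs1⟩, rfl⟩
  rw [mem_rect]
  simp only [smul_zero, zero_add, Complex.real_smul, mul_one, Complex.ofReal_im, Complex.ofReal_re]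
  exact ⟨by linarith, hh, by linarith, by linarith⟩

/-- Points of the segment `[0, 1]` have norm at most `1`. [folklore] -/
theorem norm_le_one_of_mem_segment {t : ℂ} (ht : t ∈ segment ℝ (0 : ℂ) 1) : ‖t‖ ≤ 1 := by
  rw [segment_eq_image] at ht
  obtain ⟨s, ⟨hs0, hs1⟩, rfl⟩ := ht
  simp only [smul_zero, zero_add, Complex.real_smul, mul_one, Complex.norm_real, Real.norm_eq_abs]
  rw [abs_of_nonneg hs0]
  exact hs1

/-- A closed disc around a point of `Rect h'` of radius `r` lies in `Rect h` when `h' + r ≤ h`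
(`|Re|, |Im| ≤ ‖·‖`). [folklore] -/
theorem closedBall_subset_rect {h h' r : ℝ} {c : ℂ} (hc : c ∈ Rect h') (hr : h' + r ≤ h) :
    closedBall c r ⊆ Rect h := by
  intro w hw
  rw [mem_closedBall, dist_eq_norm] at hw
  rw [mem_rect] at hc ⊢
  obtain ⟨h1, h2, h3, h4⟩ := hc
  have hre : |w.re - c.re| ≤ r := by
    have := Complex.abs_re_le_norm (w - c); rw [Complex.sub_re] at this; exact le_trans this hw
  have him : |w.im - c.im| ≤ r := by
    have := Complex.abs_im_le_norm (w - c); rw [Complex.sub_im] at this; exact le_trans this hw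
  rw [abs_le] at hre him
  obtain ⟨hre1, hre2⟩ := hre
  obtain ⟨him1, him2⟩ := him
  exact ⟨by linarith, by linarith, by linarith, by linarith⟩

/-- **Cauchy estimate on the rectangle**: `f` holomorphic with `‖f‖ ≤ K` on `Rect h`, `c ∈ Rect h'`, `h' + r ≤ h`,
`r > 0` ⇒ `‖f′(c)‖ ≤ K / r` (`Complex.norm_deriv_le_of_forall_mem_sphere_norm_le` on the disc of radius `r` around
`c`). [folklore] -/
theorem norm_deriv_le_of_rect {f : ℂ → F} {h h' r K : ℝ} (hf : DifferentiableOn ℂ f (Rect h))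
    (hK : ∀ ζ ∈ Rect h, ‖f ζ‖ ≤ K) (hr : 0 < r) (hhr : h' + r ≤ h) {c : ℂ} (hc : c ∈ Rect h') :
    ‖deriv f c‖ ≤ K / r := by
  have hsub : closedBall c r ⊆ Rect h := closedBall_subset_rect hc hhr
  have hd : DiffContOnCl ℂ f (ball c r) := by
    apply DifferentiableOn.diffContOnCl
    rw [closure_ball c hr.ne']
    exact hf.mono hsub
  exact Complex.norm_deriv_le_of_forall_mem_sphere_norm_le hr hd
    (fun z hz => hK z (hsub (sphere_subset_closedBall hz)))

/-- **First order on the strip**: `f` holomorphic with `‖f‖ ≤ K` on `Rect h`, `h > 0` ⇒ `‖f 1 − f 0‖ ≤ (2/h)·K`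
(`‖f′‖ ≤ K/(h/2)` on `Rect (h/2) ⊇ [0, 1]`, then the mean value inequality on the segment).  For `h < 1` this is
WEAKER than the crude `2K` — the strip lemma is informative only through the way `h` enters, uniformly in `h > 0`.
[folklore] -/
theorem norm_sub_le_two_div_of_rect {f : ℂ → F} {h K : ℝ} (hh : 0 < h) (hf : DifferentiableOn ℂ f (Rect h))
    (hK : ∀ ζ ∈ Rect h, ‖f ζ‖ ≤ K) : ‖f 1 - f 0‖ ≤ 2 / h * K := by
  have hseg : segment ℝ (0 : ℂ) 1 ⊆ Rect (h / 2) := segment_subset_rect (by positivity)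
  have hsub : Rect (h / 2) ⊆ Rect h := rect_mono (by linarith)
  have hderiv : ∀ ζ ∈ segment ℝ (0 : ℂ) 1, ‖deriv f ζ‖ ≤ K / (h / 2) := fun ζ hζ =>
    norm_deriv_le_of_rect hf hK (by positivity) (by linarith : h / 2 + h / 2 ≤ h) (hseg hζ)
  have hdiff : ∀ ζ ∈ segment ℝ (0 : ℂ) 1, DifferentiableAt ℂ f ζ := fun ζ hζ =>
    hf.differentiableAt ((isOpen_rect h).mem_nhds (hsub (hseg hζ)))
  have hmv := (convex_segment (0 : ℂ) 1).norm_image_sub_le_of_norm_deriv_le hdiff hderiv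
    (left_mem_segment ℝ (0 : ℂ) 1) (right_mem_segment ℝ (0 : ℂ) 1)
  rw [sub_zero, norm_one, mul_one] at hmv
  calc ‖f 1 - f 0‖ ≤ K / (h / 2) := hmv
    _ = 2 / h * K := by rw [div_div_eq_mul_div]; ring

variable [CompleteSpace F]

/-- The derivative of a function holomorphic on the (open) rectangle is holomorphic there. [folklore] -/
theorem differentiableOn_deriv_rect {f : ℂ → F} {h : ℝ} (hf : DifferentiableOn ℂ f (Rect h)) :
    DifferentiableOn ℂ (deriv f) (Rect h) :=
  ((hf.analyticOnNhd (isOpen_rect h)).deriv).differentiableOn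

/-- **Second order on the strip** (the (32)-shape): `f` holomorphic with `‖f‖ ≤ K` on `Rect h`, `h > 0`, and
`f′(0) = 0` ⇒ `‖f 1 − f 0‖ ≤ (8/h²)·K` (`‖f′‖ ≤ 2K/h` on `Rect (h/2)`, `‖f″‖ ≤ 8K/h²` on `Rect (h/4) ⊇ [0, 1]`, the mean
value inequality twice on the segment, where `‖ζ‖ ≤ 1`). [folklore] -/
theorem norm_sub_le_of_rect_derivZero {f : ℂ → F} {h K : ℝ} (hh : 0 < h) (hf : DifferentiableOn ℂ f (Rect h))
    (hK : ∀ ζ ∈ Rect h, ‖f ζ‖ ≤ K) (h0 : deriv f 0 = 0) : ‖f 1 - f 0‖ ≤ 8 / h ^ 2 * K := by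
  have hK0 : 0 ≤ K := le_trans (norm_nonneg _) (hK 0 (zero_mem_rect hh))
  have h1 : ∀ ζ ∈ Rect (h / 2), ‖deriv f ζ‖ ≤ K / (h / 2) := fun ζ hζ =>
    norm_deriv_le_of_rect hf hK (by positivity) (by linarith : h / 2 + h / 2 ≤ h) hζ
  have hf' : DifferentiableOn ℂ (deriv f) (Rect (h / 2)) :=
    (differentiableOn_deriv_rect hf).mono (rect_mono (by linarith))
  have h2 : ∀ ζ ∈ Rect (h / 4), ‖deriv (deriv f) ζ‖ ≤ K / (h / 2) / (h / 4) := fun ζ hζ =>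
    norm_deriv_le_of_rect hf' h1 (by positivity) (by linarith : h / 4 + h / 4 ≤ h / 2) hζ
  have hseg : segment ℝ (0 : ℂ) 1 ⊆ Rect (h / 4) := segment_subset_rect (by positivity)
  have hC2 : 0 ≤ K / (h / 2) / (h / 4) := by positivity
  have hdiff' : ∀ ζ ∈ segment ℝ (0 : ℂ) 1, DifferentiableAt ℂ (deriv f) ζ := fun ζ hζ =>
    hf'.differentiableAt ((isOpen_rect _).mem_nhds (rect_mono (by linarith) (hseg hζ)))
  have hC : ∀ t ∈ segment ℝ (0 : ℂ) 1, ‖deriv f t‖ ≤ K / (h / 2) / (h / 4) := by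
    intro t ht
    have hmv := (convex_segment (0 : ℂ) 1).norm_image_sub_le_of_norm_deriv_le hdiff'
      (fun ζ hζ => h2 ζ (hseg hζ)) (left_mem_segment ℝ (0 : ℂ) 1) ht
    rw [h0, sub_zero, sub_zero] at hmv
    calc ‖deriv f t‖ ≤ K / (h / 2) / (h / 4) * ‖t‖ := hmv
      _ ≤ K / (h / 2) / (h / 4) * 1 := mul_le_mul_of_nonneg_left (norm_le_one_of_mem_segment ht) hC2
      _ = K / (h / 2) / (h / 4) := mul_one _
  have hdiff : ∀ ζ ∈ segment ℝ (0 : ℂ) 1, DifferentiableAt ℂ f ζ := fun ζ hζ =>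
    hf.differentiableAt ((isOpen_rect h).mem_nhds (rect_mono (by linarith) (hseg hζ)))
  have hmv := (convex_segment (0 : ℂ) 1).norm_image_sub_le_of_norm_deriv_le hdiff hC
    (left_mem_segment ℝ (0 : ℂ) 1) (right_mem_segment ℝ (0 : ℂ) 1)
  rw [sub_zero, norm_one, mul_one] at hmv
  calc ‖f 1 - f 0‖ ≤ K / (h / 2) / (h / 4) := hmv
    _ = 8 / h ^ 2 * K := by rw [div_div, show h / 2 * (h / 4) = h ^ 2 / 8 by ring, div_div_eq_mul_div]; ring

end strip

/-! ## §2. The leaf — analyticity of the localized terms along the complex line through `U_{k+1} = 1` and `U_{k+1}` —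
and what the subtraction (61) costs: the factor `θ = 2/ρ` -/

section families

variable {D : LocDomainSys} {Φ : Type*}

/-- The DIFFERENCED family along a line: the localized term at the actual configuration `line φ 1 = φ` minus the same
term at `line φ 0` (the configuration with `U_{k+1} = 1`) — the localized pieces of (61) after the cancellation of
p. 272 *"This is cancelled by the second term in (61)"*. [cite: Balaban1985UV3, (61) p.271; p.272 (after (63))] -/
def diffAlong (E : D.Dom → Φ → ℂ) (line : Φ → ℂ → Φ) : D.Dom → Φ → ℂ :=
  fun X φ => E X (line φ 1) - E X (line φ 0)

/-- The order-`N` REMAINDER family along a line: the term at `ζ = 1` minus its Taylor polynomial of order `< N` at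
`ζ = 0` — the shape of the last term of (30)/(60). [cite: Balaban1985UV3, (30) p.263; (60) p.271] -/
def taylorRemAlong (E : D.Dom → Φ → ℂ) (line : Φ → ℂ → Φ) (N : ℕ) : D.Dom → Φ → ℂ :=
  fun X φ => E X (line φ 1) - ∑ n ∈ Finset.range N, (n.factorial : ℂ)⁻¹ • iteratedDeriv n (fun ζ => E X (line φ ζ)) 0

/-- LEAF (L1) — THE LINE STAYS IN THE ANALYTICITY DOMAIN: from every configuration `φ` of the (smaller) space `sp' X`
the complexified configurations `line φ ζ`, `|ζ| < ρ`, lie in the space `sp X` on which the undifferenced bound holds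
(`ρ` = analyticity radius / size of the deviation; for the print, `line φ ζ = exp iζη𝓗(B)` with 𝓗(B) as small as (28)).
Hypothesis only. [cite: Balaban1985UV3, (28)–(29) p.263; p.271 (before (60))] -/
def LineInDomain (sp' sp : D.Dom → Set Φ) (line : Φ → ℂ → Φ) (ρ : ℝ) : Prop :=
  ∀ X φ, φ ∈ sp' X → ∀ ζ ∈ ball (0 : ℂ) ρ, line φ ζ ∈ sp X

/-- LEAF (L2) — ANALYTICITY ALONG THE LINE: every localized term is a holomorphic function of `ζ` on `|ζ| < ρ` along the
line (p. 263: *"The third property is the analyticity with respect to U₁. These properties follow from the results of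
previous papers"*).  Hypothesis only. [cite: Balaban1985UV3, p.263 (before (27))] -/
def AnalyticAlong (sp' : D.Dom → Set Φ) (E : D.Dom → Φ → ℂ) (line : Φ → ℂ → Φ) (ρ : ℝ) : Prop :=
  ∀ X φ, φ ∈ sp' X → DifferentiableOn ℂ (fun ζ => E X (line φ ζ)) (ball (0 : ℂ) ρ)

/-- LEAF (L3) — NO FIRST-ORDER TERM: the derivative along the line vanishes at `ζ = 0` (the shape of (32), p. 271:
*"The same conclusion (32) holds for the first order functional derivative … at 𝓗 = 0"*).  Hypothesis only.
[cite: Balaban1985UV3, (32) p.264; p.271 (before (60))] -/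
def DerivZeroAlong (sp' : D.Dom → Set Φ) (E : D.Dom → Φ → ℂ) (line : Φ → ℂ → Φ) : Prop :=
  ∀ X φ, φ ∈ sp' X → deriv (fun ζ => E X (line φ ζ)) 0 = 0

variable {sp sp' : D.Dom → Set Φ} {E : D.Dom → Φ → ℂ} {line : Φ → ℂ → Φ} {nX : D.Dom → ℕ} {B r ρ : ℝ}

/-- When the line passes through `φ` at `ζ = 1`, the differenced family is `E X φ − E X (line φ 0)`. [folklore] -/
theorem diffAlong_apply_of_line_one (hline : ∀ φ, line φ 1 = φ) (X : D.Dom) (φ : Φ) :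
    diffAlong E line X φ = E X φ - E X (line φ 0) := by
  rw [diffAlong, hline]

/-- The leaves are monotone in the radius: a larger disc may be forgotten. [folklore] -/
theorem LineInDomain.mono {ρ' : ℝ} (h : LineInDomain sp' sp line ρ) (hρ : ρ' ≤ ρ) :
    LineInDomain sp' sp line ρ' :=
  fun X φ hφ ζ hζ => h X φ hφ ζ (ball_subset_ball hρ hζ)

/-- The leaves are monotone in the radius. [folklore] -/
theorem AnalyticAlong.mono {ρ' : ℝ} (h : AnalyticAlong sp' E line ρ) (hρ : ρ' ≤ ρ) :
    AnalyticAlong sp' E line ρ' :=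
  fun X φ hφ => (h X φ hφ).mono (ball_subset_ball hρ)

/-- **THE SUBTRACTION (61) COSTS THE FACTOR `2/ρ`.**  If the undifferenced localized family obeys the per-cube shape
`B13.LogHalfBound D sp E nX B r` on the analyticity spaces `sp`, and from the evaluation spaces `sp'` the complex lines
of radius `ρ > 1` stay in `sp` (L1) with the terms holomorphic along them (L2), then the differenced family obeys the
SAME shape on `sp'` with the SAME rate and the per-cube constant `(2/ρ)·B`: the per-site / per-cube smallness
`θ = 2/ρ` of cell GAPS G-adv5-5 / G-B13-12a reading (a), derived rather than assumed.  Kernel: `norm_sub_le_two_div`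
applied to `ζ ↦ E X (line φ ζ)`. [cite: Balaban1985UV3, p.272 (after (63)); (29)–(30) p.263] -/
theorem logHalfBound_diffAlong (hρ : 1 < ρ) (hdom : LineInDomain sp' sp line ρ) (han : AnalyticAlong sp' E line ρ)
    (hE : B13.LogHalfBound D sp E nX B r) :
    B13.LogHalfBound D sp' (diffAlong E line) nX (2 / ρ * B) r := by
  intro X φ hφ
  have hK : ∀ ζ ∈ ball (0 : ℂ) ρ, ‖E X (line φ ζ)‖ ≤ B * (nX X : ℝ) * Real.exp (-(r * D.dj X)) :=
    fun ζ hζ => hE X (line φ ζ) (hdom X φ hφ ζ hζ)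
  calc ‖diffAlong E line X φ‖ = ‖E X (line φ 1) - E X (line φ 0)‖ := rfl
    _ ≤ 2 / ρ * (B * (nX X : ℝ) * Real.exp (-(r * D.dj X))) :=
        norm_sub_le_two_div (f := fun ζ => E X (line φ ζ)) hρ (han X φ hφ) hK
    _ = 2 / ρ * B * (nX X : ℝ) * Real.exp (-(r * D.dj X)) := by ring

/-- The same with a named smallness: any `θ ≥ 2/ρ` (e.g. `θ = α₀ + α₁` when `ρ ≥ 2/(α₀ + α₁)`) may be booked, for
`B ≥ 0`. [folklore] -/
theorem logHalfBound_diffAlong_of_le {θ : ℝ} (hρ : 1 < ρ) (hθ : 2 / ρ ≤ θ) (hB : 0 ≤ B)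
    (hdom : LineInDomain sp' sp line ρ) (han : AnalyticAlong sp' E line ρ) (hE : B13.LogHalfBound D sp E nX B r) :
    B13.LogHalfBound D sp' (diffAlong E line) nX (θ * B) r :=
  B10LogDet63.logHalfBound_mono (mul_le_mul_of_nonneg_right hθ hB) le_rfl
    (mul_nonneg (le_trans (by positivity) hθ) hB) (logHalfBound_diffAlong hρ hdom han hE)

/-- **With (32): second-order smallness.**  If moreover the first derivative along the line vanishes at `ζ = 0` (L3)
and `ρ ≥ 4`, the differenced family obeys the shape with per-cube constant `(8/ρ²)·B`.
[cite: Balaban1985UV3, (32) p.264; p.271 (before (60))] -/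
theorem logHalfBound_diffAlong_of_derivZero (hρ : 4 ≤ ρ) (hdom : LineInDomain sp' sp line ρ)
    (han : AnalyticAlong sp' E line ρ) (h0 : DerivZeroAlong sp' E line) (hE : B13.LogHalfBound D sp E nX B r) :
    B13.LogHalfBound D sp' (diffAlong E line) nX (8 / ρ ^ 2 * B) r := by
  intro X φ hφ
  have hK : ∀ ζ ∈ ball (0 : ℂ) ρ, ‖E X (line φ ζ)‖ ≤ B * (nX X : ℝ) * Real.exp (-(r * D.dj X)) :=
    fun ζ hζ => hE X (line φ ζ) (hdom X φ hφ ζ hζ)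
  calc ‖diffAlong E line X φ‖ = ‖E X (line φ 1) - E X (line φ 0)‖ := rfl
    _ ≤ 8 / ρ ^ 2 * (B * (nX X : ℝ) * Real.exp (-(r * D.dj X))) :=
        norm_sub_le_of_deriv_zero (f := fun ζ => E X (line φ ζ)) hρ (han X φ hφ) hK (h0 X φ hφ)
    _ = 8 / ρ ^ 2 * B * (nX X : ℝ) * Real.exp (-(r * D.dj X)) := by ring

/-- **The remainder of (30)/(60) in the per-cube shape**: the order-`N` remainder family obeys the shape with constant
`2(2/ρ)^N·B` for `ρ ≥ 4` — the kernel form of *"+ O(g₀⁷)e^{−κℒ(X)}"* (N = 7, `2/ρ = O(g₀p(g₀)·…)` by (28)).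
[cite: Balaban1985UV3, (30) p.263; (60) p.271] -/
theorem logHalfBound_taylorRemAlong (hρ : 4 ≤ ρ) (hdom : LineInDomain sp' sp line ρ)
    (han : AnalyticAlong sp' E line ρ) (hE : B13.LogHalfBound D sp E nX B r) (N : ℕ) :
    B13.LogHalfBound D sp' (taylorRemAlong E line N) nX (2 * (2 / ρ) ^ N * B) r := by
  intro X φ hφ
  have hK : ∀ ζ ∈ ball (0 : ℂ) ρ, ‖E X (line φ ζ)‖ ≤ B * (nX X : ℝ) * Real.exp (-(r * D.dj X)) :=
    fun ζ hζ => hE X (line φ ζ) (hdom X φ hφ ζ hζ)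
  calc ‖taylorRemAlong E line N X φ‖
        = ‖(fun ζ => E X (line φ ζ)) 1 - ∑ n ∈ Finset.range N,
            (n.factorial : ℂ)⁻¹ • iteratedDeriv n (fun ζ => E X (line φ ζ)) 0‖ := rfl
    _ ≤ 2 * (B * (nX X : ℝ) * Real.exp (-(r * D.dj X))) * (2 / ρ) ^ N :=
        norm_sub_taylor_le_of_four_le hρ (han X φ hφ) hK N
    _ = 2 * (2 / ρ) ^ N * B * (nX X : ℝ) * Real.exp (-(r * D.dj X)) := by ring

/-- **x-dependent families, integrated** ((61) is the x-integral over `[0, 2γ₁]` of the localized terms of the first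
integral of (63), plus the series): if for every `x ∈ [0, a]` the family `E x` obeys the undifferenced shape on `sp` and
is holomorphic along the lines, the x-INTEGRATED differenced family obeys the shape on `sp'` with constant `a·(2/ρ)·B`
(`intervalIntegral.norm_integral_le_of_norm_le_const`; no measurability is needed for a norm bound).
[cite: Balaban1985UV3, (61), (63) pp.271–272] -/
theorem logHalfBound_integral_diffAlong {E : ℝ → D.Dom → Φ → ℂ} {a : ℝ} (ha : 0 ≤ a) (hρ : 1 < ρ)
    (hdom : LineInDomain sp' sp line ρ) (han : ∀ x ∈ Icc (0 : ℝ) a, AnalyticAlong sp' (E x) line ρ)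
    (hE : ∀ x ∈ Icc (0 : ℝ) a, B13.LogHalfBound D sp (E x) nX B r) :
    B13.LogHalfBound D sp' (fun X φ => ∫ x in (0 : ℝ)..a, diffAlong (E x) line X φ) nX (a * (2 / ρ * B)) r := by
  intro X φ hφ
  have hb : ∀ x ∈ Set.uIoc (0 : ℝ) a,
      ‖diffAlong (E x) line X φ‖ ≤ 2 / ρ * B * (nX X : ℝ) * Real.exp (-(r * D.dj X)) := by
    intro x hx
    rw [uIoc_of_le ha] at hx
    exact logHalfBound_diffAlong hρ hdom (han x ⟨hx.1.le, hx.2⟩) (hE x ⟨hx.1.le, hx.2⟩) X φ hφ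
  calc ‖∫ x in (0 : ℝ)..a, diffAlong (E x) line X φ‖
        ≤ 2 / ρ * B * (nX X : ℝ) * Real.exp (-(r * D.dj X)) * |a - 0| :=
        intervalIntegral.norm_integral_le_of_norm_le_const hb
    _ = a * (2 / ρ * B) * (nX X : ℝ) * Real.exp (-(r * D.dj X)) := by rw [sub_zero, abs_of_nonneg ha]; ring

end families

/-! ## §2b. Term level: the per-SITE smallness of the differenced walk terms, fed to `B10LogDet63` -/

section walks

variable {D : LocDomainSys} [DecidableEq D.Dom] {Q : Type} [DecidableEq Q] {S : Type} [Fintype S] {Φ : Type*}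
  {nbrs : Q → Finset Q} {cube : S → Q} {dom : S → List Q → D.Dom} {cubes : D.Dom → Finset Q}
  {sp sp' : D.Dom → Set Φ} {line : Φ → ℂ → Φ} {term : S → List Q → Φ → ℂ} {Dg V : ℕ} {K q r ρ : ℝ}

/-- The DIFFERENCED walk terms: each term of the expansion of `G̃₃(x)` at the actual background minus the same term at
`U_{k+1} = 1` — term by term, the cancellation of p. 272. [cite: Balaban1985UV3, p.272 (after (63))] -/
def diffTerm (term : S → List Q → Φ → ℂ) (line : Φ → ℂ → Φ) : S → List Q → Φ → ℂ :=
  fun b ω φ => term b ω (line φ 1) - term b ω (line φ 0)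

omit [DecidableEq D.Dom] [Fintype S] in
/-- **PER-SITE SMALLNESS FROM ANALYTICITY.**  If the walk terms obey the (23)-type bound
`|term b ω| ≤ K q^{|ω|} e^{−r d(dom b ω)}` on the spaces `sp`, the lines of radius `ρ > 1` from `sp'` stay in `sp` (L1)
and every term is holomorphic along them, then the differenced terms obey the same bound on `sp'` with `K ↦ K·(2/ρ)`:
the hypothesis of `B10LogDet63.logHalfBound_perSite` with `K₀ = K`, `θ = 2/ρ`. [cite: Balaban1985UV3, (23) p.262; p.272 (after (63))] -/
theorem walkBound_diffTerm (hρ : 1 < ρ) (hdom : LineInDomain sp' sp line ρ)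
    (han : ∀ (b : S) (n : ℕ) (ω : List Q) (φ : Φ), ω ∈ B9Thm37Sum.walksFrom nbrs n (cube b) → φ ∈ sp' (dom b ω) →
      DifferentiableOn ℂ (fun ζ => term b ω (line φ ζ)) (ball (0 : ℂ) ρ))
    (hterm : ∀ (b : S) (n : ℕ) (ω : List Q) (φ : Φ), ω ∈ B9Thm37Sum.walksFrom nbrs n (cube b) → φ ∈ sp (dom b ω) →
      ‖term b ω φ‖ ≤ K * q ^ n * Real.exp (-(r * D.dj (dom b ω)))) :
    ∀ (b : S) (n : ℕ) (ω : List Q) (φ : Φ), ω ∈ B9Thm37Sum.walksFrom nbrs n (cube b) → φ ∈ sp' (dom b ω) →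
      ‖diffTerm term line b ω φ‖ ≤ K * (2 / ρ) * q ^ n * Real.exp (-(r * D.dj (dom b ω))) := by
  intro b n ω φ hω hφ
  have hKζ : ∀ ζ ∈ ball (0 : ℂ) ρ, ‖term b ω (line φ ζ)‖ ≤ K * q ^ n * Real.exp (-(r * D.dj (dom b ω))) :=
    fun ζ hζ => hterm b n ω (line φ ζ) hω (hdom (dom b ω) φ hφ ζ hζ)
  calc ‖diffTerm term line b ω φ‖ = ‖term b ω (line φ 1) - term b ω (line φ 0)‖ := rfl
    _ ≤ 2 / ρ * (K * q ^ n * Real.exp (-(r * D.dj (dom b ω)))) :=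
        norm_sub_le_two_div (f := fun ζ => term b ω (line φ ζ)) hρ (han b n ω φ hω hφ) hKζ
    _ = K * (2 / ρ) * q ^ n * Real.exp (-(r * D.dj (dom b ω))) := by ring

/-- **The dichotomy of `B10LogDet63.logHalfBound_perSite`, instantiated**: under the counting hypotheses of
`B10LogDet63` (`≤ Dg` neighbours, `≤ V` sites per cube, walks start in their domain, `Dg·q < 1`) and the hypotheses of
`walkBound_diffTerm`, the localized DIFFERENCED pieces obey `B13.LogHalfBound` on `sp'` with per-cube constant
`K/(1 − Dg·q) · (2/ρ) · V` — reading (a) of G-B13-12a exactly when `(2/ρ)·V = O(1)`, i.e. when the analyticity radius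
exceeds the deviation by a factor of the order of the number of sites per cube.
[cite: Balaban1985UV3, p.272 (after (63)); (23)–(25) p.262] -/
theorem logHalfBound_diffTerm (hD : ∀ c, (nbrs c).card ≤ Dg)
    (hV : ∀ c : Q, (univ.filter fun b : S => cube b = c).card ≤ V)
    (hstart : ∀ b n ω, ω ∈ B9Thm37Sum.walksFrom nbrs n (cube b) → cube b ∈ cubes (dom b ω))
    (hK : 0 ≤ K) (hq : 0 ≤ q) (hDq : Dg * q < 1) (hρ : 1 < ρ) (hdom : LineInDomain sp' sp line ρ)
    (han : ∀ (b : S) (n : ℕ) (ω : List Q) (φ : Φ), ω ∈ B9Thm37Sum.walksFrom nbrs n (cube b) → φ ∈ sp' (dom b ω) →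
      DifferentiableOn ℂ (fun ζ => term b ω (line φ ζ)) (ball (0 : ℂ) ρ))
    (hterm : ∀ (b : S) (n : ℕ) (ω : List Q) (φ : Φ), ω ∈ B9Thm37Sum.walksFrom nbrs n (cube b) → φ ∈ sp (dom b ω) →
      ‖term b ω φ‖ ≤ K * q ^ n * Real.exp (-(r * D.dj (dom b ω)))) :
    B13.LogHalfBound D sp' (B10LogDet63.Elog nbrs cube dom (diffTerm term line)) (fun X => (cubes X).card)
      (K / (1 - Dg * q) * (2 / ρ) * V) r :=
  B10LogDet63.logHalfBound_perSite hD hV hstart hK (by positivity) hq hDq (walkBound_diffTerm hρ hdom han hterm)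

/-- **The two entry points agree**: localizing the differenced terms IS differencing the localized family —
`Elog(diffTerm term line) X φ = diffAlong (Elog term) line X φ` — whenever both endpoint configurations lie in the
space of `X` and the (23)-type bound makes the levels summable (`B10LogDet63.summable_level`; `tsum_sub`). [folklore] -/
theorem Elog_diffTerm_eq (hD : ∀ c, (nbrs c).card ≤ Dg)
    (hV : ∀ c : Q, (univ.filter fun b : S => cube b = c).card ≤ V)
    (hstart : ∀ b n ω, ω ∈ B9Thm37Sum.walksFrom nbrs n (cube b) → cube b ∈ cubes (dom b ω))
    (hK : 0 ≤ K) (hq : 0 ≤ q) (hDq : Dg * q < 1)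
    (hterm : ∀ (b : S) (n : ℕ) (ω : List Q) (φ : Φ), ω ∈ B9Thm37Sum.walksFrom nbrs n (cube b) → φ ∈ sp (dom b ω) →
      ‖term b ω φ‖ ≤ K * q ^ n * Real.exp (-(r * D.dj (dom b ω))))
    (X : D.Dom) (φ : Φ) (h1 : line φ 1 ∈ sp X) (h0 : line φ 0 ∈ sp X) :
    B10LogDet63.Elog nbrs cube dom (diffTerm term line) X φ
      = diffAlong (B10LogDet63.Elog nbrs cube dom term) line X φ := by
  have hs1 := B10LogDet63.summable_level hD hV hstart hK hq hDq hterm X h1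
  have hs0 := B10LogDet63.summable_level hD hV hstart hK hq hDq hterm X h0
  unfold B10LogDet63.Elog diffAlong
  rw [← hs1.tsum_sub hs0]
  refine tsum_congr fun n => ?_
  unfold B10LogDet63.level diffTerm
  simp only [Finset.sum_sub_distrib]

omit [DecidableEq D.Dom] [Fintype S] in
/-- **The x-uniform leaf transfers**: if the x-dependent walk terms obey `B10LogDet63.G3WalkBound` (the (23)-type bound
uniformly in `x ∈ [0, a]`) on `sp` and are holomorphic along the lines from `sp'` for every such `x`, the differenced
terms obey `G3WalkBound` on `sp'` with `K ↦ K·(2/ρ)` — x-uniformly, because `ρ` is a property of the DOMAINS, not of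
`x`. [cite: Balaban1985UV3, p.272 (after (63))] -/
theorem g3WalkBound_diffTerm {term : ℝ → S → List Q → Φ → ℂ} {a : ℝ} (hρ : 1 < ρ)
    (hdom : LineInDomain sp' sp line ρ)
    (han : ∀ x ∈ Icc (0 : ℝ) a, ∀ (b : S) (n : ℕ) (ω : List Q) (φ : Φ), ω ∈ B9Thm37Sum.walksFrom nbrs n (cube b) →
      φ ∈ sp' (dom b ω) → DifferentiableOn ℂ (fun ζ => term x b ω (line φ ζ)) (ball (0 : ℂ) ρ))
    (h : B10LogDet63.G3WalkBound D nbrs cube dom sp term K q r a) :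
    B10LogDet63.G3WalkBound D nbrs cube dom sp' (fun x => diffTerm (term x) line) (K * (2 / ρ)) q r a :=
  fun x hx b n ω φ hω hφ => walkBound_diffTerm hρ hdom (han x hx) (h x hx) b n ω φ hω hφ

/-- **(61), x-integrated, with the smallness**: the x-integrated differenced terms, regrouped by localization domain,
obey `B13.LogHalfBound` on `sp'` with constant `a·K·(2/ρ)·V/(1 − Dg·q)` — `B10LogDet63.logHalfBound_integral63` for
the differenced terms; compared with the undifferenced `a·K·V/(1 − Dg·q)` exactly the factor `2/ρ`.
[cite: Balaban1985UV3, (61), (63) pp.271–272] -/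
theorem logHalfBound_integral61 (hD : ∀ c, (nbrs c).card ≤ Dg)
    (hV : ∀ c : Q, (univ.filter fun b : S => cube b = c).card ≤ V)
    (hstart : ∀ b n ω, ω ∈ B9Thm37Sum.walksFrom nbrs n (cube b) → cube b ∈ cubes (dom b ω))
    (hK : 0 ≤ K) (hq : 0 ≤ q) (hDq : Dg * q < 1) {a : ℝ} (ha : 0 ≤ a) {term : ℝ → S → List Q → Φ → ℂ}
    (hρ : 1 < ρ) (hdom : LineInDomain sp' sp line ρ)
    (han : ∀ x ∈ Icc (0 : ℝ) a, ∀ (b : S) (n : ℕ) (ω : List Q) (φ : Φ), ω ∈ B9Thm37Sum.walksFrom nbrs n (cube b) →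
      φ ∈ sp' (dom b ω) → DifferentiableOn ℂ (fun ζ => term x b ω (line φ ζ)) (ball (0 : ℂ) ρ))
    (h : B10LogDet63.G3WalkBound D nbrs cube dom sp term K q r a) :
    B13.LogHalfBound D sp' (B10LogDet63.Elog nbrs cube dom fun b ω φ => ∫ x in (0 : ℝ)..a, diffTerm (term x) line b ω φ)
      (fun X => (cubes X).card) (a * (K * (2 / ρ)) * V / (1 - Dg * q)) r :=
  B10LogDet63.logHalfBound_integral63 hD hV hstart (by positivity) hq hDq ha (g3WalkBound_diffTerm hρ hdom han h)

omit [DecidableEq D.Dom] [Fintype S] in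
/-- **The representation passes to differences**: if the data `R x b` (the resolvent entries at the actual background)
are represented level by level by their walk terms on a set `𝒰` containing both endpoint configurations of the lines
from `𝒰'` (`B10Eq63Rep.G3Rep`), then the DIFFERENCES `R x b (line φ 1) − R x b (line φ 0)` are represented by the
differenced terms on `𝒰'` (`HasSum.sub`) — the (61) difference has the expansion obtained by subtracting term by term,
which is what *"This is cancelled by the second term in (61)"* does. [cite: Balaban1985UV3, p.272 (after (63))] -/
theorem g3Rep_diffTerm {term : ℝ → S → List Q → Φ → ℂ} {R : ℝ → S → Φ → ℂ} {𝒰 𝒰' : Set Φ} {a : ℝ}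
    (h : B10Eq63Rep.G3Rep nbrs cube term R 𝒰 a) (h1 : ∀ φ ∈ 𝒰', line φ 1 ∈ 𝒰) (h0 : ∀ φ ∈ 𝒰', line φ 0 ∈ 𝒰) :
    B10Eq63Rep.G3Rep nbrs cube (fun x => diffTerm (term x) line)
      (fun x b φ => R x b (line φ 1) - R x b (line φ 0)) 𝒰' a := by
  intro x hx b φ hφ
  have key := (h x hx b (line φ 1) (h1 φ hφ)).sub (h x hx b (line φ 0) (h0 φ hφ))
  show HasSum (fun n : ℕ => ∑ ω ∈ B9Thm37Sum.walksFrom nbrs n (cube b), diffTerm (term x) line b ω φ)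
    (R x b (line φ 1) - R x b (line φ 0))
  have hfun : (fun n : ℕ => ∑ ω ∈ B9Thm37Sum.walksFrom nbrs n (cube b), diffTerm (term x) line b ω φ)
      = fun n : ℕ => (∑ ω ∈ B9Thm37Sum.walksFrom nbrs n (cube b), term x b ω (line φ 1))
          - ∑ ω ∈ B9Thm37Sum.walksFrom nbrs n (cube b), term x b ω (line φ 0) := by
    funext n
    simp only [diffTerm, Finset.sum_sub_distrib]
  rw [hfun]
  exact key

end walks

/-! ## §2c. X-DEPENDENT half-widths: the leaves on strips, and what the subtraction (61) costs then -/

section stripFamilies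

variable {D : LocDomainSys} {Φ : Type*}

/-- The differenced family along X-DEPENDENT lines `line X φ : ℂ → Φ` (the gauge `exp iζη𝓗(B)` of p. 263 lives on a
neighbourhood `□₁` of the localization domain, so the line depends on X): the term at `line X φ 1` minus the term at
`line X φ 0`. [cite: Balaban1985UV3, (61) p.271; (29) p.263] -/
def diffAlongV (E : D.Dom → Φ → ℂ) (line : D.Dom → Φ → ℂ → Φ) : D.Dom → Φ → ℂ :=
  fun X φ => E X (line X φ 1) - E X (line X φ 0)

/-- The X-independent lines of §2 are a special case. [folklore] -/
theorem diffAlong_eq_diffAlongV (E : D.Dom → Φ → ℂ) (line : Φ → ℂ → Φ) :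
    diffAlong E line = diffAlongV E (fun _ => line) := rfl

/-- LEAF (L1′) — THE LINE STAYS IN THE ANALYTICITY DOMAIN ON A STRIP OF X-DEPENDENT HALF-WIDTH `h X`: from every
configuration of `sp' X` the complexified configurations `line X φ ζ`, `ζ ∈ Rect (h X)`, lie in `sp X`.  For the print
`h X` is set by the POTENTIAL-type conditions of the analyticity spaces ([I] (1.12)–(1.13); [5] (3.35), (3.69)) and
decreases with `LM` and with the size of X (§3b).  Hypothesis only.
[cite: Balaban1985UV3, (28)–(29) p.263; Balaban1987RG1, (1.12)–(1.13) p.262] -/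
def LineInStrip (sp' sp : D.Dom → Set Φ) (line : D.Dom → Φ → ℂ → Φ) (h : D.Dom → ℝ) : Prop :=
  ∀ X φ, φ ∈ sp' X → ∀ ζ ∈ Rect (h X), line X φ ζ ∈ sp X

/-- LEAF (L2′) — ANALYTICITY ALONG THE LINE on the strip. Hypothesis only. [cite: Balaban1985UV3, p.263 (before (27))] -/
def AnalyticOnStrip (sp' : D.Dom → Set Φ) (E : D.Dom → Φ → ℂ) (line : D.Dom → Φ → ℂ → Φ) (h : D.Dom → ℝ) :
    Prop :=
  ∀ X φ, φ ∈ sp' X → DifferentiableOn ℂ (fun ζ => E X (line X φ ζ)) (Rect (h X))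

/-- LEAF (L3′) — NO FIRST-ORDER TERM along the X-dependent line (the (32)-shape; PRINTED for `𝒫′₁` (p. 264) and
`𝒫′_{k+1}` (p. 271), for the (61)-pieces only *"analyzed in the same way as the perturbative expressions"* (p. 271) —
the vanishing follows from gauge invariance + semi-simplicity for ANY gauge invariant localized function, but that
derivation is the paper's, not the kernel's).  Hypothesis only. [cite: Balaban1985UV3, (32) p.264; p.271 (before (60))] -/
def DerivZeroAlongV (sp' : D.Dom → Set Φ) (E : D.Dom → Φ → ℂ) (line : D.Dom → Φ → ℂ → Φ) : Prop :=
  ∀ X φ, φ ∈ sp' X → deriv (fun ζ => E X (line X φ ζ)) 0 = 0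

variable {sp sp' : D.Dom → Set Φ} {E : D.Dom → Φ → ℂ} {line : D.Dom → Φ → ℂ → Φ} {nX : D.Dom → ℕ}
  {h : D.Dom → ℝ} {B r θ₀ : ℝ}

/-- Pointwise, first order: `‖diff‖ ≤ (2 / h X)·(undifferenced bound)`. [folklore] -/
theorem norm_diffAlongV_le {X : D.Dom} {φ : Φ} (hh : 0 < h X) (hdom : LineInStrip sp' sp line h)
    (han : AnalyticOnStrip sp' E line h) (hE : B13.LogHalfBound D sp E nX B r) (hφ : φ ∈ sp' X) :
    ‖diffAlongV E line X φ‖ ≤ 2 / h X * (B * (nX X : ℝ) * Real.exp (-(r * D.dj X))) :=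
  norm_sub_le_two_div_of_rect (f := fun ζ => E X (line X φ ζ)) hh (han X φ hφ)
    (fun ζ hζ => hE X (line X φ ζ) (hdom X φ hφ ζ hζ))

/-- Pointwise, second order (with (L3′)): `‖diff‖ ≤ (8 / (h X)²)·(undifferenced bound)`. [folklore] -/
theorem norm_diffAlongV_le_of_derivZero {X : D.Dom} {φ : Φ} (hh : 0 < h X) (hdom : LineInStrip sp' sp line h)
    (han : AnalyticOnStrip sp' E line h) (h0 : DerivZeroAlongV sp' E line) (hE : B13.LogHalfBound D sp E nX B r)
    (hφ : φ ∈ sp' X) :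
    ‖diffAlongV E line X φ‖ ≤ 8 / h X ^ 2 * (B * (nX X : ℝ) * Real.exp (-(r * D.dj X))) :=
  norm_sub_le_of_rect_derivZero (f := fun ζ => E X (line X φ ζ)) hh (han X φ hφ)
    (fun ζ hζ => hE X (line X φ ζ) (hdom X φ hφ ζ hζ)) (h0 X φ hφ)

/-- `1 + d ≤ e^d` in the form used to absorb polynomial growth in the tree length into the rate. [folklore] -/
theorem one_add_mul_exp_le (d r : ℝ) :
    (1 + d) * Real.exp (-(r * d)) ≤ Real.exp (-((r - 1) * d)) := by
  have he : 1 + d ≤ Real.exp d := by have := Real.add_one_le_exp d; linarith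
  calc (1 + d) * Real.exp (-(r * d)) ≤ Real.exp d * Real.exp (-(r * d)) :=
        mul_le_mul_of_nonneg_right he (Real.exp_pos _).le
    _ = Real.exp (-((r - 1) * d)) := by rw [← Real.exp_add]; congr 1; ring

/-- `(1 + d)² ≤ e^{2d}`, same purpose. [folklore] -/
theorem one_add_sq_mul_exp_le (d r : ℝ) (hd : 0 ≤ d) :
    (1 + d) ^ 2 * Real.exp (-(r * d)) ≤ Real.exp (-((r - 2) * d)) := by
  have he : 1 + d ≤ Real.exp d := by have := Real.add_one_le_exp d; linarith
  have he2 : (1 + d) ^ 2 ≤ Real.exp d * Real.exp d := by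
    rw [pow_two]; exact mul_le_mul he he (by linarith) (Real.exp_pos _).le
  calc (1 + d) ^ 2 * Real.exp (-(r * d)) ≤ Real.exp d * Real.exp d * Real.exp (-(r * d)) :=
        mul_le_mul_of_nonneg_right he2 (Real.exp_pos _).le
    _ = Real.exp (-((r - 2) * d)) := by rw [← Real.exp_add, ← Real.exp_add]; congr 1; ring

/-- **THE SUBTRACTION (61) ON STRIPS, FIRST ORDER.**  If the half-widths satisfy `1/h X ≤ θ₀·(1 + d(X))` (the printed
shape: the potential over the localization domain grows linearly with its size), the differenced family obeys the
per-cube shape with constant `2θ₀·B` and rate `r − 1` (the factor `1 + d` absorbed by `1 + d ≤ e^d`).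
[cite: Balaban1985UV3, p.272 (after (63)); (28)–(30) p.263] -/
theorem logHalfBound_diffAlongV (hh : ∀ X, 0 < h X) (hH : ∀ X, (h X)⁻¹ ≤ θ₀ * (1 + D.dj X)) (hθ₀ : 0 ≤ θ₀)
    (hB : 0 ≤ B) (hdom : LineInStrip sp' sp line h) (han : AnalyticOnStrip sp' E line h)
    (hE : B13.LogHalfBound D sp E nX B r) :
    B13.LogHalfBound D sp' (diffAlongV E line) nX (2 * θ₀ * B) (r - 1) := by
  intro X φ hφ
  have hd : 0 ≤ D.dj X := D.dj_nonneg X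
  have hn : (0 : ℝ) ≤ (nX X : ℝ) := Nat.cast_nonneg _
  have h2 : 2 / h X ≤ 2 * θ₀ * (1 + D.dj X) := by
    rw [div_eq_mul_inv]; nlinarith [hH X]
  calc ‖diffAlongV E line X φ‖ ≤ 2 / h X * (B * (nX X : ℝ) * Real.exp (-(r * D.dj X))) :=
        norm_diffAlongV_le (hh X) hdom han hE hφ
    _ ≤ 2 * θ₀ * (1 + D.dj X) * (B * (nX X : ℝ) * Real.exp (-(r * D.dj X))) :=
        mul_le_mul_of_nonneg_right h2 (by positivity)
    _ = 2 * θ₀ * B * (nX X : ℝ) * ((1 + D.dj X) * Real.exp (-(r * D.dj X))) := by ring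
    _ ≤ 2 * θ₀ * B * (nX X : ℝ) * Real.exp (-((r - 1) * D.dj X)) :=
        mul_le_mul_of_nonneg_left (one_add_mul_exp_le _ r) (by positivity)

/-- **THE SUBTRACTION (61) ON STRIPS, SECOND ORDER** (with the (32)-shape (L3′)): constant `8θ₀²·B`, rate `r − 2`.
[cite: Balaban1985UV3, (32) p.264; p.271 (before (60)); p.272 (after (63))] -/
theorem logHalfBound_diffAlongV_of_derivZero (hh : ∀ X, 0 < h X) (hH : ∀ X, (h X)⁻¹ ≤ θ₀ * (1 + D.dj X))
    (hB : 0 ≤ B) (hdom : LineInStrip sp' sp line h) (han : AnalyticOnStrip sp' E line h)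
    (h0 : DerivZeroAlongV sp' E line) (hE : B13.LogHalfBound D sp E nX B r) :
    B13.LogHalfBound D sp' (diffAlongV E line) nX (8 * θ₀ ^ 2 * B) (r - 2) := by
  intro X φ hφ
  have hd : 0 ≤ D.dj X := D.dj_nonneg X
  have hn : (0 : ℝ) ≤ (nX X : ℝ) := Nat.cast_nonneg _
  have hinv : 0 ≤ (h X)⁻¹ := inv_nonneg.mpr (hh X).le
  have hsq : (h X)⁻¹ ^ 2 ≤ (θ₀ * (1 + D.dj X)) ^ 2 := pow_le_pow_left₀ hinv (hH X) 2
  have h8 : 8 / h X ^ 2 ≤ 8 * θ₀ ^ 2 * (1 + D.dj X) ^ 2 := by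
    rw [div_eq_mul_inv, ← inv_pow]; nlinarith [hsq]
  calc ‖diffAlongV E line X φ‖ ≤ 8 / h X ^ 2 * (B * (nX X : ℝ) * Real.exp (-(r * D.dj X))) :=
        norm_diffAlongV_le_of_derivZero (hh X) hdom han h0 hE hφ
    _ ≤ 8 * θ₀ ^ 2 * (1 + D.dj X) ^ 2 * (B * (nX X : ℝ) * Real.exp (-(r * D.dj X))) :=
        mul_le_mul_of_nonneg_right h8 (by positivity)
    _ = 8 * θ₀ ^ 2 * B * (nX X : ℝ) * ((1 + D.dj X) ^ 2 * Real.exp (-(r * D.dj X))) := by ring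
    _ ≤ 8 * θ₀ ^ 2 * B * (nX X : ℝ) * Real.exp (-((r - 2) * D.dj X)) :=
        mul_le_mul_of_nonneg_left (one_add_sq_mul_exp_le _ r hd) (by positivity)

/-- **x-dependent families, integrated, second order** ((61) = the x-integral over `[0, 2γ₁]` of the first integral
of (63)): constant `a·8θ₀²·B`, rate `r − 2`. [cite: Balaban1985UV3, (61), (63) pp.271–272] -/
theorem logHalfBound_integral_diffAlongV_of_derivZero {E : ℝ → D.Dom → Φ → ℂ} {a : ℝ} (ha : 0 ≤ a)
    (hh : ∀ X, 0 < h X) (hH : ∀ X, (h X)⁻¹ ≤ θ₀ * (1 + D.dj X)) (hB : 0 ≤ B)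
    (hdom : LineInStrip sp' sp line h) (han : ∀ x ∈ Icc (0 : ℝ) a, AnalyticOnStrip sp' (E x) line h)
    (h0 : ∀ x ∈ Icc (0 : ℝ) a, DerivZeroAlongV sp' (E x) line)
    (hE : ∀ x ∈ Icc (0 : ℝ) a, B13.LogHalfBound D sp (E x) nX B r) :
    B13.LogHalfBound D sp' (fun X φ => ∫ x in (0 : ℝ)..a, diffAlongV (E x) line X φ) nX
      (a * (8 * θ₀ ^ 2 * B)) (r - 2) := by
  intro X φ hφ
  have hb : ∀ x ∈ Set.uIoc (0 : ℝ) a,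
      ‖diffAlongV (E x) line X φ‖ ≤ 8 * θ₀ ^ 2 * B * (nX X : ℝ) * Real.exp (-((r - 2) * D.dj X)) := by
    intro x hx
    rw [uIoc_of_le ha] at hx
    exact logHalfBound_diffAlongV_of_derivZero hh hH hB hdom (han x ⟨hx.1.le, hx.2⟩) (h0 x ⟨hx.1.le, hx.2⟩)
      (hE x ⟨hx.1.le, hx.2⟩) X φ hφ
  calc ‖∫ x in (0 : ℝ)..a, diffAlongV (E x) line X φ‖
        ≤ 8 * θ₀ ^ 2 * B * (nX X : ℝ) * Real.exp (-((r - 2) * D.dj X)) * |a - 0| :=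
        intervalIntegral.norm_integral_le_of_norm_le_const hb
    _ = a * (8 * θ₀ ^ 2 * B) * (nX X : ℝ) * Real.exp (-((r - 2) * D.dj X)) := by
        rw [sub_zero, abs_of_nonneg ha]; ring

/-- Crude pointwise bound WITHOUT cancellation: if only the two endpoint configurations lie in `sp X`, the
differenced term is at most twice the undifferenced bound (`B10LogDet63.logHalfBound_sub` pointwise). [folklore] -/
theorem norm_diffAlongV_le_two {X : D.Dom} {φ : Φ} (h1 : line X φ 1 ∈ sp X) (h0 : line X φ 0 ∈ sp X)
    (hE : B13.LogHalfBound D sp E nX B r) :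
    ‖diffAlongV E line X φ‖ ≤ 2 * (B * (nX X : ℝ) * Real.exp (-(r * D.dj X))) := by
  calc ‖diffAlongV E line X φ‖ = ‖E X (line X φ 1) - E X (line X φ 0)‖ := rfl
    _ ≤ ‖E X (line X φ 1)‖ + ‖E X (line X φ 0)‖ := norm_sub_le _ _
    _ ≤ B * (nX X : ℝ) * Real.exp (-(r * D.dj X)) + B * (nX X : ℝ) * Real.exp (-(r * D.dj X)) :=
        add_le_add (hE X _ h1) (hE X _ h0)
    _ = 2 * (B * (nX X : ℝ) * Real.exp (-(r * D.dj X))) := by ring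

/-- LEAF (L0′) — ENDPOINTS IN THE DOMAIN, for every X: the actual configuration `line X φ 1` and the one with
`U_{k+1} = 1`, `line X φ 0`, belong to the analyticity space (no complex line needed).  Hypothesis only.
[cite: Balaban1985UV3, (61) p.271] -/
def EndpointsIn (sp' sp : D.Dom → Set Φ) (line : D.Dom → Φ → ℂ → Φ) : Prop :=
  ∀ X φ, φ ∈ sp' X → line X φ 1 ∈ sp X ∧ line X φ 0 ∈ sp X

/-- The evaluation spaces CUT OFF at tree length `d₀`: `below d₀ sp' X = sp' X` if `d(X) ≤ d₀`, `= ∅` otherwise.  The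
leaves (L1′)–(L3′) stated for `below d₀ sp'` ask for the complex line only on the SMALL localization domains — cf.
print, where the expansion (29)–(30) is performed for a localization domain *"contained in a cube □ of the size RM₁"*
with the gauge `exp i𝓗(B)` on *"a neighbourhood of □₁, where □₁ is a cube of the size 3RM₁"* (p. 263), and (28)
*"|B(c)| < 4L²|c₋ − y|g₀p(g₀)"* grows linearly with the distance from the center; treating the domains beyond the
cutoff by the crude bound is THIS MODULE's bookkeeping (cell DIVERGENCE D-b10.22), not a printed step.
[cite: Balaban1985UV3, p.263 (before (28))] -/
def below (d₀ : ℝ) (sp' : D.Dom → Set Φ) : D.Dom → Set Φ := fun X => {φ | φ ∈ sp' X ∧ D.dj X ≤ d₀}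

/-- **TWO REGIMES**: cancellation (second order) on the domains with `d(X) ≤ d₀`, the crude bound `2·B` on the others,
where `e^{−r d} = e^{−2d}·e^{−(r−2)d} ≤ e^{−2d₀}·e^{−(r−2)d}`: the differenced family obeys the per-cube shape with
constant `8θ₀²B + 2B·e^{−2d₀}` and rate `r − 2`. [cite: Balaban1985UV3, (27)–(30) p.263; p.272 (after (63))] -/
theorem logHalfBound_diffAlongV_twoRegime (d₀ : ℝ) (hh : ∀ X, 0 < h X) (hH : ∀ X, (h X)⁻¹ ≤ θ₀ * (1 + D.dj X))
    (hB : 0 ≤ B) (hend : EndpointsIn sp' sp line) (hdom : LineInStrip (below d₀ sp') sp line h)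
    (han : AnalyticOnStrip (below d₀ sp') E line h) (h0 : DerivZeroAlongV (below d₀ sp') E line)
    (hE : B13.LogHalfBound D sp E nX B r) :
    B13.LogHalfBound D sp' (diffAlongV E line) nX (8 * θ₀ ^ 2 * B + 2 * B * Real.exp (-(2 * d₀))) (r - 2) := by
  intro X φ hφ
  have hd : 0 ≤ D.dj X := D.dj_nonneg X
  have hn : (0 : ℝ) ≤ (nX X : ℝ) := Nat.cast_nonneg _
  have hpos : 0 ≤ (nX X : ℝ) * Real.exp (-((r - 2) * D.dj X)) := by positivity
  have hC₁ : 8 * θ₀ ^ 2 * B ≤ 8 * θ₀ ^ 2 * B + 2 * B * Real.exp (-(2 * d₀)) := by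
    have := mul_nonneg (mul_nonneg zero_le_two hB) (Real.exp_pos (-(2 * d₀))).le; linarith
  have hC₂ : 2 * B * Real.exp (-(2 * d₀)) ≤ 8 * θ₀ ^ 2 * B + 2 * B * Real.exp (-(2 * d₀)) := by
    have := mul_nonneg (mul_nonneg (by norm_num : (0 : ℝ) ≤ 8) (sq_nonneg θ₀)) hB; linarith
  by_cases hX : D.dj X ≤ d₀
  · have hs := logHalfBound_diffAlongV_of_derivZero hh hH hB hdom han h0 hE X φ ⟨hφ, hX⟩
    calc ‖diffAlongV E line X φ‖ ≤ 8 * θ₀ ^ 2 * B * (nX X : ℝ) * Real.exp (-((r - 2) * D.dj X)) := hs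
      _ = 8 * θ₀ ^ 2 * B * ((nX X : ℝ) * Real.exp (-((r - 2) * D.dj X))) := by ring
      _ ≤ (8 * θ₀ ^ 2 * B + 2 * B * Real.exp (-(2 * d₀))) * ((nX X : ℝ) * Real.exp (-((r - 2) * D.dj X))) :=
          mul_le_mul_of_nonneg_right hC₁ hpos
      _ = (8 * θ₀ ^ 2 * B + 2 * B * Real.exp (-(2 * d₀))) * (nX X : ℝ) * Real.exp (-((r - 2) * D.dj X)) := by
          ring
  · rw [not_le] at hX
    obtain ⟨h1, h0'⟩ := hend X φ hφ
    have hl := norm_diffAlongV_le_two h1 h0' hE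
    have hexp : Real.exp (-(r * D.dj X)) = Real.exp (-(2 * D.dj X)) * Real.exp (-((r - 2) * D.dj X)) := by
      rw [← Real.exp_add]; congr 1; ring
    have hle : Real.exp (-(2 * D.dj X)) ≤ Real.exp (-(2 * d₀)) := Real.exp_le_exp.mpr (by linarith)
    calc ‖diffAlongV E line X φ‖ ≤ 2 * (B * (nX X : ℝ) * Real.exp (-(r * D.dj X))) := hl
      _ = 2 * B * Real.exp (-(2 * D.dj X)) * ((nX X : ℝ) * Real.exp (-((r - 2) * D.dj X))) := by
          rw [hexp]; ring
      _ ≤ 2 * B * Real.exp (-(2 * d₀)) * ((nX X : ℝ) * Real.exp (-((r - 2) * D.dj X))) :=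
          mul_le_mul_of_nonneg_right (mul_le_mul_of_nonneg_left hle (by positivity)) hpos
      _ ≤ (8 * θ₀ ^ 2 * B + 2 * B * Real.exp (-(2 * d₀))) * ((nX X : ℝ) * Real.exp (-((r - 2) * D.dj X))) :=
          mul_le_mul_of_nonneg_right hC₂ hpos
      _ = (8 * θ₀ ^ 2 * B + 2 * B * Real.exp (-(2 * d₀))) * (nX X : ℝ) * Real.exp (-((r - 2) * D.dj X)) := by
          ring

/-- The PRINTED SHAPE of the half-width satisfies the hypothesis `1/h ≤ θ₀(1 + d)`: if `h X = a / (p + q·(1 + d(X)))`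
(`a` = the complex-direction constant of the BIG analyticity space — the `α′₁` of [Balaban1988RG2Cluster] p. 15 —;
`p` = the complex part `α₁` already present, (1.13); `q·(1 + d)` = the size of the real gauge-fixed potential over the
localization domain, (1.12): `q = O(1)·B·LM·α₀`), then `1/h X ≤ ((p + q)/a)·(1 + d(X))`. [folklore] -/
theorem inv_halfWidth_le {a p q d : ℝ} (ha : 0 < a) (hp : 0 ≤ p) (hd : 0 ≤ d) :
    (a / (p + q * (1 + d)))⁻¹ ≤ (p + q) / a * (1 + d) := by
  rw [inv_div, div_le_iff₀ ha]
  have : (p + q) / a * (1 + d) * a = (p + q) * (1 + d) := by field_simp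
  rw [this]; nlinarith

end stripFamilies

/-! ## §3. Reading (a) of *"an absolute constant instead of E₀"*, derived modulo the leaf -/

section readingA

variable {D : LocDomainSys} {Φ : Type*} {sp sp' : D.Dom → Set Φ} {E : D.Dom → Φ → ℂ} {line : Φ → ℂ → Φ}
  {nX : D.Dom → ℕ}

/-- **Reading (a) of [Balaban1988RG2Cluster] p. 21, kernel-derived from the analyticity leaf** (cell GAPS G-B13-12a,
G-adv5-5 REPAIR).  Suppose the UNDIFFERENCED localized pieces obey the per-cube shape with `B = A·(LM)⁴` — an O(1)
constant `A` per site times the `(LM)⁴` sites of an LM-cube, which is all that the volume bounds (44)–(46) of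
[Balaban1985UV3] assert — on spaces `sp` containing the complex lines of radius `ε/α₀` issued from the evaluation
spaces `sp'` (L1), the pieces being holomorphic along them (L2); here `α₀ < ε`, `ε` = the radius of the complex
background-field domain on which the (63)-expansion is controlled, in the units in which `sp' X` = Uᶜ_{k+1}(X, α₀, α₁)
has radius `α₀`.  Then the DIFFERENCED pieces obey (I.1.18) on `sp'` with constant `2·(2A/ε)·c₁` and rate `r − 1`
(`B13.bound118_of_logHalfBound_literal` with `θ := α₀ ≤ α₀ + α₁` and the printed restriction `Consts.R21`,
`(LM)⁴α₀ ≤ 1`; `c₁` = the constant of the volume bound `B13.VolBoundK1`).  The constant is ABSOLUTE iff the leaf (L1)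
holds at radius `ε/α₀` with `ε` (and `A`, `c₁`) L, M-independent — which, the bond deviation of a configuration of
Uᶜ_{k+1}(X, α₀, α₁) being `O(1)LMBα₀·(1 + d_{k+1}(X))` by [I] (1.12) p. 262 (one gauge on the dependence set), requires
the (63)-terms' analyticity domain to be
plaquette-stated and the line to stay in it beyond the linear regime; a bond-stated domain gives
`ρ ≤ ε/(O(1)LMBα₀ + α₁)` and a surviving factor `O(1)B·LM` after R21 (DOCFIX v1.1, cell GAPS C-adv2-63 O1; the printed
domains ARE potential-stated, §0 v1.1, so this first-order theorem does NOT deliver an absolute constant — see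
`bound118_secondOrder_of_R21`, §3b).  Nothing printed is asserted.
[cite: Balaban1988RG2Cluster, pp.20–21 (R21 and the closing paragraph)] -/
theorem bound118_literal_of_analyticRadius (c : B13.Consts) (h21 : c.R21) (hα₀ : 0 < c.α₀) (hα₁ : 0 ≤ c.α₁)
    {A ε r c₁ : ℝ} (hA : 0 ≤ A) (hε : c.α₀ < ε) (hc₁ : 0 ≤ c₁)
    (hdom : LineInDomain sp' sp line (ε / c.α₀)) (han : AnalyticAlong sp' E line (ε / c.α₀))
    (hE : B13.LogHalfBound D sp E nX (A * ((c.L : ℝ) * c.M) ^ 4) r) (hvol : B13.VolBoundK1 D nX c₁) :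
    B13.Bound118 D sp' (diffAlong E line) (2 * (2 * A / ε) * c₁) (r - 1) := by
  have hε0 : 0 < ε := lt_trans hα₀ hε
  have hρ : 1 < ε / c.α₀ := by rwa [lt_div_iff₀ hα₀, one_mul]
  have h := logHalfBound_diffAlong hρ hdom han hE
  have heq : 2 / (ε / c.α₀) * (A * ((c.L : ℝ) * c.M) ^ 4) = 2 * A / ε * c.α₀ * ((c.L : ℝ) * c.M) ^ 4 := by
    field_simp
  rw [heq] at h
  exact B13.bound118_of_logHalfBound_literal D sp' (diffAlong E line) nX c (by positivity) hα₀.le (by linarith)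
    h21 hc₁ h hvol

/-- The same bookkeeping without the `Consts` record: undifferenced per-cube constant `A·V` (`V` sites per cube),
lines of radius `ρ = ε/α` (`α` = deviation, `ε` = analyticity radius, `α < ε`) ⇒ differenced per-cube constant
`(2A/ε)·α·V` — a per-site constant `2A/ε` times the smallness `α` times the volume: the shape `A'·θ·(LM)^d` of
`B13.bound118_of_logHalfBound_literal` / `B10LogDet63.logHalfBound_perSite`, with `θ = α`. [folklore] -/
theorem logHalfBound_diffAlong_radius {A V α ε r : ℝ} (hα : 0 < α) (hε : α < ε)
    (hdom : LineInDomain sp' sp line (ε / α)) (han : AnalyticAlong sp' E line (ε / α))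
    (hE : B13.LogHalfBound D sp E nX (A * V) r) :
    B13.LogHalfBound D sp' (diffAlong E line) nX (2 * A / ε * α * V) r := by
  have hε0 : 0 < ε := lt_trans hα hε
  have hρ : 1 < ε / α := by rwa [lt_div_iff₀ hα, one_mul]
  have h := logHalfBound_diffAlong hρ hdom han hE
  have heq : 2 / (ε / α) * (A * V) = 2 * A / ε * α * V := by
    field_simp
  rwa [heq] at h

end readingA

/-! ## §3b. Readings (a)/(b) revisited with the located half-width: FIRST ORDER is one power of `LM` short,
SECOND ORDER is absolute under the printed R21 -/

section secondOrder

variable {D : LocDomainSys} {Φ : Type*} {sp sp' : D.Dom → Set Φ} {E : D.Dom → Φ → ℂ}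
  {line : D.Dom → Φ → ℂ → Φ} {nX : D.Dom → ℕ} {h : D.Dom → ℝ}

/-- Pure arithmetic of the printed restriction R21 at FIRST order: with `θ₀ = (α₁ + c₀·LM·α₀)/a` the per-LM-cube
constant `2θ₀·A(LM)⁴` is at most `2A(1 + c₀·LM)/a` — the factor `LM` multiplying `c₀` SURVIVES
(`(LM)⁴α₀ ≤ 1` controls `LM·(LM)⁴α₀` only up to `LM`; cell GAPS C-adv2-63 O1(i)).
[cite: Balaban1988RG2Cluster, p.20 (before the definition of C₃)] -/
theorem firstOrder_of_R21 (c : B13.Consts) (h21 : c.R21) (hLM : 0 ≤ (c.L : ℝ) * c.M)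
    {A a c₀ : ℝ} (hA : 0 ≤ A) (ha : 0 < a) (hc₀ : 0 ≤ c₀) :
    2 * ((c.α₁ + c₀ * ((c.L : ℝ) * c.M) * c.α₀) / a) * (A * ((c.L : ℝ) * c.M) ^ 4)
      ≤ 2 * A * (1 + c₀ * ((c.L : ℝ) * c.M)) / a := by
  obtain ⟨h0, h1, -, -⟩ := h21
  set v : ℝ := (c.L : ℝ) * c.M with hv
  have e1 : c.α₁ * v ^ 4 ≤ 1 := by rw [mul_comm]; exact h1
  have e2 : c₀ * v * c.α₀ * v ^ 4 ≤ c₀ * v := by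
    have h0' : c.α₀ * v ^ 4 ≤ 1 := by rw [mul_comm]; exact h0
    calc c₀ * v * c.α₀ * v ^ 4 = c₀ * v * (c.α₀ * v ^ 4) := by ring
      _ ≤ c₀ * v * 1 := mul_le_mul_of_nonneg_left h0' (mul_nonneg hc₀ hLM)
      _ = c₀ * v := mul_one _
  have key : 2 * (c.α₁ + c₀ * v * c.α₀) * (A * v ^ 4) ≤ 2 * A * (1 + c₀ * v) := by
    calc 2 * (c.α₁ + c₀ * v * c.α₀) * (A * v ^ 4) = 2 * A * (c.α₁ * v ^ 4 + c₀ * v * c.α₀ * v ^ 4) := by ring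
      _ ≤ 2 * A * (1 + c₀ * v) := mul_le_mul_of_nonneg_left (add_le_add e1 e2) (by positivity)
  calc 2 * ((c.α₁ + c₀ * v * c.α₀) / a) * (A * v ^ 4) = 2 * (c.α₁ + c₀ * v * c.α₀) * (A * v ^ 4) / a := by ring
    _ ≤ 2 * A * (1 + c₀ * v) / a := div_le_div_of_nonneg_right key ha.le

/-- **Pure arithmetic of the printed restriction R21 at SECOND order**: with the same `θ₀` the per-LM-cube constant
`8θ₀²·A(LM)⁴` is at most `16A(1 + c₀²)/a²` — NO factor of `L`, `M` survives, because `(LM)⁴·(LM·α₀)² = ((LM)⁴α₀)²·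
(LM)⁻² ≤ 1` and `(LM)⁴α₁² ≤ 1` under R21 (with `LM ≥ 1`).  This is the whole point of this Part: the second-order
smallness of the `U_{k+1}`-dependence ((32): *"there are no relevant variables"*) is exactly what the printed R21 can
pay for. [cite: Balaban1988RG2Cluster, p.20 (before the definition of C₃)] -/
theorem secondOrder_of_R21 (c : B13.Consts) (h21 : c.R21) (hLM : 1 ≤ (c.L : ℝ) * c.M) (hα₀ : 0 ≤ c.α₀)
    (hα₁ : 0 ≤ c.α₁) {A c₀ : ℝ} (a : ℝ) (hA : 0 ≤ A) :
    8 * ((c.α₁ + c₀ * ((c.L : ℝ) * c.M) * c.α₀) / a) ^ 2 * (A * ((c.L : ℝ) * c.M) ^ 4)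
      ≤ 16 * A * (1 + c₀ ^ 2) / a ^ 2 := by
  obtain ⟨h0, h1, -, -⟩ := h21
  set v : ℝ := (c.L : ℝ) * c.M with hv
  have hv0 : 0 ≤ v := le_trans zero_le_one hLM
  have hv4 : 1 ≤ v ^ 4 := one_le_pow₀ hLM
  have hv24 : v ^ 2 ≤ v ^ 4 := pow_le_pow_right₀ hLM (by norm_num)
  have h0' : c.α₀ * v ^ 4 ≤ 1 := by rw [mul_comm]; exact h0
  have h1' : c.α₁ * v ^ 4 ≤ 1 := by rw [mul_comm]; exact h1
  have hα₁1 : c.α₁ ≤ 1 := le_trans (le_mul_of_one_le_right hα₁ hv4) h1'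
  have hα₀v2 : c.α₀ * v ^ 2 ≤ 1 := le_trans (mul_le_mul_of_nonneg_left hv24 hα₀) h0'
  have e1 : c.α₁ ^ 2 * v ^ 4 ≤ 1 := by
    calc c.α₁ ^ 2 * v ^ 4 = c.α₁ * (c.α₁ * v ^ 4) := by ring
      _ ≤ 1 * 1 := mul_le_mul hα₁1 h1' (by positivity) zero_le_one
      _ = 1 := mul_one _
  have e2 : v ^ 2 * c.α₀ ^ 2 * v ^ 4 ≤ 1 := by
    calc v ^ 2 * c.α₀ ^ 2 * v ^ 4 = (c.α₀ * v ^ 4) * (c.α₀ * v ^ 2) := by ring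
      _ ≤ 1 * 1 := mul_le_mul h0' hα₀v2 (by positivity) zero_le_one
      _ = 1 := mul_one _
  have hsq : (c.α₁ + c₀ * v * c.α₀) ^ 2 ≤ 2 * c.α₁ ^ 2 + 2 * (c₀ * v * c.α₀) ^ 2 := by
    nlinarith [sq_nonneg (c.α₁ - c₀ * v * c.α₀)]
  have hp : (c.α₁ + c₀ * v * c.α₀) ^ 2 * v ^ 4 ≤ 2 * (1 + c₀ ^ 2) := by
    calc (c.α₁ + c₀ * v * c.α₀) ^ 2 * v ^ 4 ≤ (2 * c.α₁ ^ 2 + 2 * (c₀ * v * c.α₀) ^ 2) * v ^ 4 :=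
          mul_le_mul_of_nonneg_right hsq (by positivity)
      _ = 2 * (c.α₁ ^ 2 * v ^ 4) + 2 * c₀ ^ 2 * (v ^ 2 * c.α₀ ^ 2 * v ^ 4) := by ring
      _ ≤ 2 * 1 + 2 * c₀ ^ 2 * 1 :=
          add_le_add (by linarith) (mul_le_mul_of_nonneg_left e2 (by positivity))
      _ = 2 * (1 + c₀ ^ 2) := by ring
  have key : 8 * A * ((c.α₁ + c₀ * v * c.α₀) ^ 2 * v ^ 4) ≤ 8 * A * (2 * (1 + c₀ ^ 2)) :=
    mul_le_mul_of_nonneg_left hp (by positivity)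
  calc 8 * ((c.α₁ + c₀ * v * c.α₀) / a) ^ 2 * (A * v ^ 4)
        = 8 * A * ((c.α₁ + c₀ * v * c.α₀) ^ 2 * v ^ 4) / a ^ 2 := by rw [div_pow]; ring
    _ ≤ 8 * A * (2 * (1 + c₀ ^ 2)) / a ^ 2 := div_le_div_of_nonneg_right key (sq_nonneg a)
    _ = 16 * A * (1 + c₀ ^ 2) / a ^ 2 := by ring

/-- **FIRST ORDER in the letters of [Balaban1988RG2Cluster] — reading (a) NOT reached.**  Undifferenced pieces with the
per-LM-cube constant `A·(LM)⁴` (O(1) per site, [16] (44)–(46)); half-widths of the located shape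
`1/h X ≤ ((α₁ + c₀·LM·α₀)/a)·(1 + d_{k+1}(X))` (`a` = the complex-direction constant α′₁ of the big analyticity space,
p. 15; `c₀·LM·α₀` = the gauge-fixed real potential on an O(1)LM-cube, [I] (1.12); `α₁` = the complex part, [I] (1.13));
printed R21 ⇒ the differenced pieces obey the per-cube shape with constant `2A(1 + c₀·LM)/a` and rate `r − 1`: a
factor `LM` survives — by the first-order mechanism alone the constant replacing `E₀` is NOT absolute (cell GAPS
C-adv2-63 O1(i), typed).  Nothing printed is asserted. [cite: Balaban1988RG2Cluster, pp.15, 20–21] -/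
theorem logHalfBound_firstOrder_of_R21 (c : B13.Consts) (h21 : c.R21) (hLM : 0 ≤ (c.L : ℝ) * c.M)
    (hα₀ : 0 ≤ c.α₀) (hα₁ : 0 ≤ c.α₁) {A a c₀ r : ℝ} (hA : 0 ≤ A) (ha : 0 < a) (hc₀ : 0 ≤ c₀)
    (hh : ∀ X, 0 < h X) (hH : ∀ X, (h X)⁻¹ ≤ (c.α₁ + c₀ * ((c.L : ℝ) * c.M) * c.α₀) / a * (1 + D.dj X))
    (hdom : LineInStrip sp' sp line h) (han : AnalyticOnStrip sp' E line h)
    (hE : B13.LogHalfBound D sp E nX (A * ((c.L : ℝ) * c.M) ^ 4) r) :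
    B13.LogHalfBound D sp' (diffAlongV E line) nX (2 * A * (1 + c₀ * ((c.L : ℝ) * c.M)) / a) (r - 1) := by
  have hθ₀ : 0 ≤ (c.α₁ + c₀ * ((c.L : ℝ) * c.M) * c.α₀) / a := by positivity
  have h := logHalfBound_diffAlongV hh hH hθ₀ (by positivity) hdom han hE
  exact B10LogDet63.logHalfBound_mono (firstOrder_of_R21 c h21 hLM hA ha hc₀) le_rfl (by positivity) h

/-- **SECOND ORDER in the letters of [Balaban1988RG2Cluster] — reading (a) REACHED under the printed R21.**  Same
data plus the (32)-shape (L3′) ⇒ the differenced pieces obey the per-cube shape with the constant `16A(1 + c₀²)/a²`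
— INDEPENDENT of `L`, `M` — and rate `r − 2`.  With `a` (= α′₁, p. 15: *"constants α′₀, α′₁ much bigger than α₀,
α₁"*), `A` and `c₀` absolute this is p. 21's *"with an absolute constant instead of E₀"*, at the price of two units of
the decay rate.  PROVISO, load-bearing: `a` must be α-, L-, M-independent — the B9-tube reading (`a` = the threshold
`a₁` of [13] Theorem 3.4 p. 400, *"There exists a positive constant a₁ such that the operators … extend to
configurations U′U for α₁ ≤ a₁ as analytic functions"*; cell GAPS C-B13-30 / G-B13-12a UPDATE (b13-g14)); were
`α′₁ = C·α₁` a mere multiple, `θ₀²(LM)⁴` keeps `(LM)⁴` and nothing is gained.  Compare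
`B13LogHalfRadius.bound118_of_R21_radius` (first order, printed exponent 4: one power of LM short) and
`B13LogHalfRadius.bound118_absolute_of_pow5` (first order, UNPRINTED exponent 5: absolute): the second order trades the
unprinted exponent for the leaf (L3′).  All inputs are hypotheses (the leaves (L1′)–(L3′), the undifferenced bound, the
half-width shape); the theorem is their bookkeeping. [cite: Balaban1988RG2Cluster, pp.15, 20–21; Balaban1985UV3, (32) p.264, p.272] -/
theorem logHalfBound_secondOrder_of_R21 (c : B13.Consts) (h21 : c.R21) (hLM : 1 ≤ (c.L : ℝ) * c.M)
    (hα₀ : 0 ≤ c.α₀) (hα₁ : 0 ≤ c.α₁) {A a c₀ r : ℝ} (hA : 0 ≤ A)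
    (hh : ∀ X, 0 < h X) (hH : ∀ X, (h X)⁻¹ ≤ (c.α₁ + c₀ * ((c.L : ℝ) * c.M) * c.α₀) / a * (1 + D.dj X))
    (hdom : LineInStrip sp' sp line h) (han : AnalyticOnStrip sp' E line h) (h0 : DerivZeroAlongV sp' E line)
    (hE : B13.LogHalfBound D sp E nX (A * ((c.L : ℝ) * c.M) ^ 4) r) :
    B13.LogHalfBound D sp' (diffAlongV E line) nX (16 * A * (1 + c₀ ^ 2) / a ^ 2) (r - 2) := by
  have h := logHalfBound_diffAlongV_of_derivZero hh hH (by positivity) hdom han h0 hE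
  exact B10LogDet63.logHalfBound_mono (secondOrder_of_R21 c h21 hLM hα₀ hα₁ a hA) le_rfl (by positivity) h

/-- **(I.1.18) for the differenced pieces with an L, M-INDEPENDENT constant** (reading (a) of cell GAPS G-B13-12a,
derived modulo the leaves): second order + the volume bound `nX ≤ c₁(1 + d)` ⇒ `Bound118` with constant
`(16A(1 + c₀²)/a²)·c₁` and rate `r − 3` (`B13.bound118_of_logHalfBound`).  With the printed rate `r = δ₀M` the three
lost units are immaterial next to the printed *"δ₀M ≥ κ"* (p. 21) in the constant order `M` after `κ` (the tree's
`B13.Consts.R24sharp` asks `κ + 1 ≤ δ₀M`; here `κ + 3 ≤ δ₀M` would be consumed — cell DIVERGENCE D-b10.22).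
[cite: Balaban1988RG2Cluster, p.21 (closing paragraph)] -/
theorem bound118_secondOrder_of_R21 (c : B13.Consts) (h21 : c.R21) (hLM : 1 ≤ (c.L : ℝ) * c.M)
    (hα₀ : 0 ≤ c.α₀) (hα₁ : 0 ≤ c.α₁) {A a c₀ r c₁ : ℝ} (hA : 0 ≤ A)
    (hh : ∀ X, 0 < h X) (hH : ∀ X, (h X)⁻¹ ≤ (c.α₁ + c₀ * ((c.L : ℝ) * c.M) * c.α₀) / a * (1 + D.dj X))
    (hdom : LineInStrip sp' sp line h) (han : AnalyticOnStrip sp' E line h) (h0 : DerivZeroAlongV sp' E line)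
    (hE : B13.LogHalfBound D sp E nX (A * ((c.L : ℝ) * c.M) ^ 4) r) (hvol : B13.VolBoundK1 D nX c₁)
    (hc₁ : 0 ≤ c₁) :
    B13.Bound118 D sp' (diffAlongV E line) (16 * A * (1 + c₀ ^ 2) / a ^ 2 * c₁) (r - 3) := by
  have hlog := logHalfBound_secondOrder_of_R21 c h21 hLM hα₀ hα₁ hA hh hH hdom han h0 hE
  have hB : 0 ≤ 16 * A * (1 + c₀ ^ 2) / a ^ 2 := by positivity
  have h := B13.bound118_of_logHalfBound D sp' (diffAlongV E line) nX hB hlog hvol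
  exact B13.bound118_mono D sp' (diffAlongV E line) le_rfl (by linarith) (by positivity) h

/-- **SECOND ORDER, TWO REGIMES, in the letters of [Balaban1988RG2Cluster]**: cancellation only on the localization
domains with `d_{k+1}(X) ≤ d₀`, where `(LM)⁴e^{−2d₀} ≤ 1` (e.g. `d₀ = 2 log(LM)` — a CHOICE of this module, not a
printed constant: cell DIVERGENCE D-b10.22); the crude bound elsewhere.  Per-cube constant `16A(1 + c₀²)/a² + 2A` —
L, M-INDEPENDENT — at rate `r − 2`.  So the complex line (and the gauge `exp iη𝓗(B)` on a neighbourhood of X̃) is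
needed only for domains of tree length `≤ 2 log(LM)`, on which the potential is `O((1 + log LM)·LM·B·α₀)` — still
within the big space under R21.  All inputs hypotheses. [cite: Balaban1988RG2Cluster, pp.15, 20–21; Balaban1985UV3, p.263, p.272] -/
theorem logHalfBound_secondOrder_twoRegime_of_R21 (c : B13.Consts) (h21 : c.R21) (hLM : 1 ≤ (c.L : ℝ) * c.M)
    (hα₀ : 0 ≤ c.α₀) (hα₁ : 0 ≤ c.α₁) {A a c₀ r d₀ : ℝ} (hA : 0 ≤ A)
    (hd₀ : ((c.L : ℝ) * c.M) ^ 4 * Real.exp (-(2 * d₀)) ≤ 1)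
    (hh : ∀ X, 0 < h X) (hH : ∀ X, (h X)⁻¹ ≤ (c.α₁ + c₀ * ((c.L : ℝ) * c.M) * c.α₀) / a * (1 + D.dj X))
    (hend : EndpointsIn sp' sp line) (hdom : LineInStrip (below d₀ sp') sp line h)
    (han : AnalyticOnStrip (below d₀ sp') E line h) (h0 : DerivZeroAlongV (below d₀ sp') E line)
    (hE : B13.LogHalfBound D sp E nX (A * ((c.L : ℝ) * c.M) ^ 4) r) :
    B13.LogHalfBound D sp' (diffAlongV E line) nX (16 * A * (1 + c₀ ^ 2) / a ^ 2 + 2 * A) (r - 2) := by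
  have h := logHalfBound_diffAlongV_twoRegime d₀ hh hH (by positivity) hend hdom han h0 hE
  have h2 : 2 * (A * ((c.L : ℝ) * c.M) ^ 4) * Real.exp (-(2 * d₀)) ≤ 2 * A := by
    calc 2 * (A * ((c.L : ℝ) * c.M) ^ 4) * Real.exp (-(2 * d₀))
          = 2 * A * (((c.L : ℝ) * c.M) ^ 4 * Real.exp (-(2 * d₀))) := by ring
      _ ≤ 2 * A * 1 := mul_le_mul_of_nonneg_left hd₀ (by positivity)
      _ = 2 * A := mul_one _
  exact B10LogDet63.logHalfBound_mono (add_le_add (secondOrder_of_R21 c h21 hLM hα₀ hα₁ a hA) h2) le_rfl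
    (by positivity) h

end secondOrder

/-! ## §4. The operator-level form of the same smallness (recorded for the walk terms; not used by §§2–3) [folklore] -/

section toolbox

variable {m : Type*} [Fintype m] [DecidableEq m] {𝕜 : Type*} [Field 𝕜]

/-- **Second resolvent identity** for invertible matrices: `A⁻¹ − B⁻¹ = A⁻¹ (B − A) B⁻¹`. [folklore] -/
theorem inv_sub_inv_eq (A B : Matrix m m 𝕜) (hA : IsUnit A.det) (hB : IsUnit B.det) :
    A⁻¹ - B⁻¹ = A⁻¹ * (B - A) * B⁻¹ := by
  have e1 : A⁻¹ * (B - A) * B⁻¹ = A⁻¹ * (B * B⁻¹) - A⁻¹ * A * B⁻¹ := by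
    rw [Matrix.mul_sub, Matrix.sub_mul, Matrix.mul_assoc]
  rw [e1, Matrix.mul_nonsing_inv B hB, Matrix.nonsing_inv_mul A hA, Matrix.mul_one, Matrix.one_mul]

/-- **With the `x·1` shift the middle factor is x-FREE**: `(x·1 + T₁)⁻¹ − (x·1 + T₀)⁻¹ =
(x·1 + T₁)⁻¹ (T₀ − T₁) (x·1 + T₀)⁻¹` — for the operators of (63), `T_U = C*Δ_k(U)C` and `T₁ = C*Δ_k(1)C`, the
difference of the resolvents at ANY `x` is the product of two resolvents (bounded uniformly in `x ≥ 0` by positivity)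
with the x-independent, local difference `C*(Δ_k(1) − Δ_k(U))C`; whatever smallness the latter has is x-uniform.
[cite: Balaban1985UV3, (61), (63) pp.271–272] -/
theorem resolvent_sub_resolvent (T₁ T₀ : Matrix m m 𝕜) (x : 𝕜) (h₁ : IsUnit (x • (1 : Matrix m m 𝕜) + T₁).det)
    (h₀ : IsUnit (x • (1 : Matrix m m 𝕜) + T₀).det) :
    (x • (1 : Matrix m m 𝕜) + T₁)⁻¹ - (x • (1 : Matrix m m 𝕜) + T₀)⁻¹
      = (x • (1 : Matrix m m 𝕜) + T₁)⁻¹ * (T₀ - T₁) * (x • (1 : Matrix m m 𝕜) + T₀)⁻¹ := by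
  have hmid : T₀ - T₁ = (x • (1 : Matrix m m 𝕜) + T₀) - (x • (1 : Matrix m m 𝕜) + T₁) := by
    rw [add_sub_add_left_eq_sub]
  rw [hmid]
  exact inv_sub_inv_eq _ _ h₁ h₀

variable {𝔄 : Type*} [NormedRing 𝔄] [NormOneClass 𝔄]

/-- Ordered products are bounded by the products of the bounds (`‖1‖ = 1`, `‖ab‖ ≤ ‖a‖‖b‖`). [folklore] -/
theorem norm_prod_map_range_le (a : ℕ → 𝔄) (c : ℕ → ℝ) (n : ℕ) (ha : ∀ i < n, ‖a i‖ ≤ c i) :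
    ‖((List.range n).map a).prod‖ ≤ ∏ i ∈ Finset.range n, c i := by
  induction n with
  | zero => simp
  | succ n ih =>
    have ha' : ∀ i < n, ‖a i‖ ≤ c i := fun i hi => ha i (Nat.lt_succ_of_lt hi)
    have hcn : 0 ≤ ∏ i ∈ Finset.range n, c i := le_trans (norm_nonneg _) (ih ha')
    rw [List.prod_range_succ, Finset.prod_range_succ]
    calc ‖((List.range n).map a).prod * a n‖ ≤ ‖((List.range n).map a).prod‖ * ‖a n‖ := norm_mul_le _ _
      _ ≤ (∏ i ∈ Finset.range n, c i) * c n :=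
          mul_le_mul (ih ha') (ha n (Nat.lt_succ_self n)) (norm_nonneg _) hcn

/-- **Telescoping**: if `‖aᵢ‖, ‖bᵢ‖ ≤ cᵢ` and `‖aᵢ − bᵢ‖ ≤ θ·cᵢ` for `i < n` (`θ ≥ 0`), then
`‖Π_{i<n} aᵢ − Π_{i<n} bᵢ‖ ≤ n·θ·Π_{i<n} cᵢ` (ordered products; `Πa·aₙ − Πb·bₙ = (Πa − Πb)·aₙ + Πb·(aₙ − bₙ)`).  The
shape by which a walk term — an ordered product of `|ω| + O(1)` local factors depending on the background through
finitely many bond variables each — inherits a per-factor smallness `θ` with a prefactor LINEAR in `|ω|`, still summable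
against the per-step factor `q^{|ω|}` (`Σ_n (n + 1)(Dg·q)ⁿ < ∞`). [folklore] -/
theorem norm_prod_sub_prod_le (a b : ℕ → 𝔄) (c : ℕ → ℝ) {θ : ℝ} (hθ : 0 ≤ θ) (n : ℕ)
    (ha : ∀ i < n, ‖a i‖ ≤ c i) (hb : ∀ i < n, ‖b i‖ ≤ c i) (hab : ∀ i < n, ‖a i - b i‖ ≤ θ * c i) :
    ‖((List.range n).map a).prod - ((List.range n).map b).prod‖ ≤ n * θ * ∏ i ∈ Finset.range n, c i := by
  induction n with
  | zero => simp
  | succ n ih =>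
    have ha' : ∀ i < n, ‖a i‖ ≤ c i := fun i hi => ha i (Nat.lt_succ_of_lt hi)
    have hb' : ∀ i < n, ‖b i‖ ≤ c i := fun i hi => hb i (Nat.lt_succ_of_lt hi)
    have hab' : ∀ i < n, ‖a i - b i‖ ≤ θ * c i := fun i hi => hab i (Nat.lt_succ_of_lt hi)
    have hP := ih ha' hb' hab'
    have hR := norm_prod_map_range_le b c n hb'
    have hcn : 0 ≤ ∏ i ∈ Finset.range n, c i := le_trans (norm_nonneg _) hR
    have hnθ : 0 ≤ (n : ℝ) * θ * ∏ i ∈ Finset.range n, c i := by positivity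
    rw [List.prod_range_succ, List.prod_range_succ, Finset.prod_range_succ]
    set P := ((List.range n).map a).prod
    set R := ((List.range n).map b).prod
    have hsplit : P * a n - R * b n = (P - R) * a n + R * (a n - b n) := by noncomm_ring
    rw [hsplit]
    calc ‖(P - R) * a n + R * (a n - b n)‖ ≤ ‖P - R‖ * ‖a n‖ + ‖R‖ * ‖a n - b n‖ :=
          (norm_add_le _ _).trans (add_le_add (norm_mul_le _ _) (norm_mul_le _ _))
      _ ≤ ((n : ℝ) * θ * ∏ i ∈ Finset.range n, c i) * c n + (∏ i ∈ Finset.range n, c i) * (θ * c n) :=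
          add_le_add (mul_le_mul hP (ha n (Nat.lt_succ_self n)) (norm_nonneg _) hnθ)
            (mul_le_mul hR (hab n (Nat.lt_succ_self n)) (norm_nonneg _) hcn)
      _ = ((n + 1 : ℕ) : ℝ) * θ * ((∏ i ∈ Finset.range n, c i) * c n) := by push_cast; ring

end toolbox

/-! ## §5. Non-vacuity: the leaves and the undifferenced bound are jointly satisfiable by a non-constant family -/

section examples

/-- The one-domain system with tree length `0` (for the examples only). [folklore] -/
def unitSys : LocDomainSys where
  Dom := Unit
  dj := fun _ => 0
  dj_nonneg := fun _ => le_rfl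

/-- The data of the examples: configurations `Φ = ℂ`, the line `ζ ↦ ζ·φ` through `0` (= "U = 1") and `φ`, evaluation
space the closed unit disc, analyticity space the open disc of radius `ρ`, the family `E X φ = (B/ρ)·φ` — holomorphic,
bounded by `B` on the analyticity space, and NOT constant. [folklore] -/
theorem example_lineInDomain {ρ : ℝ} :
    LineInDomain (D := unitSys) (fun _ => closedBall (0 : ℂ) 1) (fun _ => ball (0 : ℂ) ρ) (fun φ ζ => ζ * φ) ρ := by
  intro X φ hφ ζ hζ
  rw [mem_closedBall_zero_iff] at hφ
  rw [mem_ball_zero_iff] at hζ ⊢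
  calc ‖ζ * φ‖ = ‖ζ‖ * ‖φ‖ := norm_mul _ _
    _ ≤ ‖ζ‖ * 1 := mul_le_mul_of_nonneg_left hφ (norm_nonneg _)
    _ < ρ := by rw [mul_one]; exact hζ

/-- (L2) for the example family. [folklore] -/
theorem example_analyticAlong {ρ B : ℝ} :
    AnalyticAlong (D := unitSys) (fun _ => closedBall (0 : ℂ) 1) (fun _ φ => ((B / ρ : ℝ) : ℂ) * φ)
      (fun φ ζ => ζ * φ) ρ := by
  intro X φ hφ
  exact ((differentiable_id.mul_const φ).const_mul _).differentiableOn

/-- The undifferenced bound for the example family (`nX ≡ 1`, rate `0`). [folklore] -/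
theorem example_logHalfBound {ρ B : ℝ} (hρ : 0 < ρ) (hB : 0 ≤ B) :
    B13.LogHalfBound unitSys (fun _ => ball (0 : ℂ) ρ) (fun _ φ => ((B / ρ : ℝ) : ℂ) * φ) (fun _ => 1) B 0 := by
  intro X φ hφ
  rw [mem_ball_zero_iff] at hφ
  have h1 : ‖((B / ρ : ℝ) : ℂ) * φ‖ = B / ρ * ‖φ‖ := by
    rw [norm_mul, Complex.norm_real, Real.norm_of_nonneg (by positivity)]
  rw [h1]
  calc B / ρ * ‖φ‖ ≤ B / ρ * ρ := mul_le_mul_of_nonneg_left hφ.le (by positivity)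
    _ = B * ((1 : ℕ) : ℝ) * Real.exp (-(0 * unitSys.dj X)) := by
        rw [zero_mul, neg_zero, Real.exp_zero, Nat.cast_one, mul_one, mul_one]; field_simp

/-- **Non-vacuity of `logHalfBound_diffAlong`**: for the example data the theorem applies and yields the bound
`(2/ρ)·B` for the (non-zero) differenced family `(B/ρ)·φ − 0` on the closed unit disc — no hypothesis is `False`.
[folklore] -/
example {ρ B : ℝ} (hρ : 1 < ρ) (hB : 0 ≤ B) :
    B13.LogHalfBound unitSys (fun _ => closedBall (0 : ℂ) 1)
      (diffAlong (fun _ φ => ((B / ρ : ℝ) : ℂ) * φ) (fun φ ζ => ζ * φ)) (fun _ => 1) (2 / ρ * B) 0 :=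
  logHalfBound_diffAlong hρ example_lineInDomain example_analyticAlong
    (example_logHalfBound (lt_trans zero_lt_one hρ) hB)

/-- The example's differenced family is genuinely non-zero (at `φ = 1`, `B ≠ 0`): the leaves do not force triviality.
[folklore] -/
example {ρ B : ℝ} (hρ : 1 < ρ) (hB : B ≠ 0) :
    diffAlong (D := unitSys) (fun _ φ => ((B / ρ : ℝ) : ℂ) * φ) (fun φ ζ => ζ * φ) () 1 ≠ 0 := by
  have hρ0 : ρ ≠ 0 := (lt_trans zero_lt_one hρ).ne'
  simp [diffAlong, hB, hρ0]

end examples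

/-! ## §5b. Non-vacuity of the strip leaves, second order: a non-constant family with all of (L1′)–(L3′) -/

section examplesStrip

/-- (L1′) for the data: `Φ = ℂ`, lines `ζ ↦ ζ·φ`, evaluation space the closed unit disc, analyticity space the open
disc of radius `3 ⊇` the image of `Rect 1` (`‖ζ‖ ≤ |Re ζ| + |Im ζ| < 3` there), half-width `h ≡ 1`. [folklore] -/
theorem example_lineInStrip :
    LineInStrip (D := unitSys) (fun _ => closedBall (0 : ℂ) 1) (fun _ => ball (0 : ℂ) 3) (fun _ φ ζ => ζ * φ)
      (fun _ => 1) := by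
  intro X φ hφ ζ hζ
  rw [mem_closedBall_zero_iff] at hφ
  rw [mem_rect] at hζ
  obtain ⟨h1, h2, h3, h4⟩ := hζ
  rw [mem_ball_zero_iff, norm_mul]
  have hζn : ‖ζ‖ < 3 := by
    have := Complex.norm_le_abs_re_add_abs_im ζ
    have hre : |ζ.re| < 2 := abs_lt.mpr ⟨by linarith, by linarith⟩
    have him : |ζ.im| < 1 := abs_lt.mpr ⟨by linarith, by linarith⟩
    linarith
  calc ‖ζ‖ * ‖φ‖ ≤ ‖ζ‖ * 1 := mul_le_mul_of_nonneg_left hφ (norm_nonneg _)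
    _ < 3 := by rw [mul_one]; exact hζn

/-- (L2′) for the family `E X φ = φ²` (holomorphic along the lines, NOT constant). [folklore] -/
theorem example_analyticOnStrip :
    AnalyticOnStrip (D := unitSys) (fun _ => closedBall (0 : ℂ) 1) (fun _ φ => φ ^ 2) (fun _ φ ζ => ζ * φ)
      (fun _ => 1) := by
  intro X φ _
  exact ((differentiable_id.mul_const φ).pow 2).differentiableOn

/-- (L3′) for the family `φ²`: `d/dζ (ζφ)² = 2ζφ² = 0` at `ζ = 0` — the (32)-shape holds non-trivially. [folklore] -/
theorem example_derivZeroAlongV :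
    DerivZeroAlongV (D := unitSys) (fun _ => closedBall (0 : ℂ) 1) (fun _ φ => φ ^ 2) (fun _ φ ζ => ζ * φ) := by
  intro X φ _
  have hd : HasDerivAt (fun ζ : ℂ => (ζ * φ) ^ 2) (((2 : ℕ) : ℂ) * (0 * φ) ^ (2 - 1) * φ) 0 :=
    (hasDerivAt_mul_const φ).pow 2
  rw [hd.deriv]; simp

/-- The undifferenced bound for `φ²` on the disc of radius `3` (`nX ≡ 1`, constant `9`, rate `0`). [folklore] -/
theorem example_logHalfBound_sq :
    B13.LogHalfBound unitSys (fun _ => ball (0 : ℂ) 3) (fun _ φ => φ ^ 2) (fun _ => 1) 9 0 := by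
  intro X φ hφ
  rw [mem_ball_zero_iff] at hφ
  rw [norm_pow]
  have h9 : ‖φ‖ ^ 2 ≤ 3 ^ 2 := pow_le_pow_left₀ (norm_nonneg _) hφ.le 2
  calc ‖φ‖ ^ 2 ≤ 3 ^ 2 := h9
    _ = 9 * ((1 : ℕ) : ℝ) * Real.exp (-(0 * unitSys.dj X)) := by
        rw [zero_mul, neg_zero, Real.exp_zero, Nat.cast_one]; norm_num

/-- **Non-vacuity of `logHalfBound_diffAlongV_of_derivZero`**: the leaves (L1′)–(L3′), the half-width hypothesis
(`h ≡ 1`, `θ₀ = 1`) and the undifferenced bound hold together for the NON-CONSTANT family `φ²`, and the theorem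
yields the constant `8·1²·9` at rate `0 − 2` — no hypothesis is `False`. [folklore] -/
example :
    B13.LogHalfBound unitSys (fun _ => closedBall (0 : ℂ) 1)
      (diffAlongV (fun _ φ => φ ^ 2) (fun _ φ ζ => ζ * φ)) (fun _ => 1) (8 * 1 ^ 2 * 9) (0 - 2) :=
  logHalfBound_diffAlongV_of_derivZero (θ₀ := 1) (fun _ => one_pos)
    (fun X => by change (1 : ℝ)⁻¹ ≤ 1 * (1 + 0); norm_num) (by norm_num)
    example_lineInStrip example_analyticOnStrip example_derivZeroAlongV example_logHalfBound_sq

/-- The example's differenced family is genuinely non-zero (at `φ = 1`). [folklore] -/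
example : diffAlongV (D := unitSys) (fun _ φ => φ ^ 2) (fun _ φ ζ => ζ * φ) () 1 ≠ 0 := by
  simp [diffAlongV]

end examplesStrip

end Literature.MathematicalPhysics.QuantumFieldTheory.Balaban1983to89.B10Eq61PerSite

end
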